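import Mathlib
import Literature.MathematicalPhysics.QuantumFieldTheory.Balaban1983to89.Step
import Literature.MathematicalPhysics.QuantumFieldTheory.Balaban1983to89.B16MergeGeometry
import Literature.MathematicalPhysics.QuantumFieldTheory.Balaban1983to89.B16CubeCurrency

/-!
# `Balaban1983to89.B16Lem384Induction` — [Balaban1989LargeFieldII] p. 384, THE INDUCTIVE STATEMENT with (1.80):
«We prove this statement by an induction with respect to j» (pp. 384–387) ASSEMBLED in the bookkeeping model from
the printed cases

T. Bałaban, *Large field renormalization. II. Localization, exponentiation, and bounds for the 𝐑 operation*, Commun.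
Math. Phys. **122** (1989) 355–392 [Balaban1989LargeFieldII] (cell paper B16; PDF held
`paper:balaban1989-cmp122-large-field-ii`, journal page = PDF page + 354; pp. 384–387 = PDF 30–33, re-read by this seat in
the text layer `p0030.txt`–`p0033.txt` and on the x2 renders
`run/shared/lean/pub/pub-balaban/b2b-balaban-ref1/pages/1989-cmp122-large-field-II/…-p030-x2.png` … `…-p033-x2.png`).

statement-level skeleton of published theorems with citation tags; proofs where landed; nothing here is a claim about
the Yang–Mills mass gap

CITATION HEADER / WHAT IS REPRODUCED.  Mega-formalization `lit-balaban`, HOME `run/shared/lean/pub/lit-balaban/`;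
reader/typer **r13 gen 18** (B16 display-level owner; rows `lit-balaban-r13/ROWS-B16.md` v2.66).  SKELETON row
**B16.Lem@384** (owner r13; «the INDUCTIVE STATEMENT with (1.80) (unnumbered lemma, proof pp.384–387 by induction on
j)», head `typed-existing (statement)` = `Step.Budget.Controls` / `Step.Budget.ScaleData.Invariant`), with rows
B16.Eq1.80–1.88 / B16.Lem@387 whose displayed arithmetic the cell `pub-balaban` (units b2b-balaban-f2 / -b02) proved as
kernel theorems over named binders: `Step.Budget.base_182` ((1.82), base case), `case1_183` ((1.83), case 1),
`reset_p386` (the p. 386 reset), `merge` / `merge_eq_186` / `merge_step` / `merge_controls` ((1.85)–(1.88), the inner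
induction on the number of domains; b02՚s `B16MergeGeometry.merge_controls_conn` is the same induction with the
connectivity premises on the cost binder, and `B16MergeGeometry` / `B16SProfile` / `B16StoppingRule` / `B16MergeHorizon`
discharge geometric binders in the ℤᵈ index model).  The cell՚s recipe (`pub-balaban/STEP.md` item 9) binds a consumer՚s regions to
`Step.Budget.ScaleData j` and says «(1.80) for all components is `ScaleData.Invariant b D`», leaving THE OUTER INDUCTION
ON `j` — the passage from `Invariant` at scale `j` to `Invariant` at scale `j+1` through the printed case analysis, and
its iteration from the base case — to the consumer: no theorem of the tree states it.  THIS FILE supplies exactly that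
glue, over the same abstract bookkeeping carriers, importing `Step` only and modifying nothing.

THE PRINT (pp. 384–387 [PDF 30–33], verbatim where quoted).  p. 384: «The factor exp(−κ_j(Z)) controls K
renormalization steps, under the assumption that no large fields are created in these steps, where the number K is the
smallest positive integer having the property that the domain S^K(Z) … satisfies the conditions (i), (ii), with N = R_j.
More precisely this means that κ_j(Z) ≧ Σ_{n=j+1}^{j+K} O(1)M^dR_n^{d+1}d′_n(S^{n−j}(Z)). (1.80)  We prove this statement by
an induction with respect to j.»  p. 385: «Now we prove the statement for j = 1. Take a component Z of the region Z₁.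
… From the definition of κ₁(Z) we get the following bound: κ₁(Z) ≧ ¼γ₀(14)^{−d}A₁²p₀²(g₁)(d′₁(Z)+1) − O(1)M^dR₁^{d+1}d′₁(Z).
(1.82) Thus, by the estimate (1.81), the statement holds for j = 1 … if [¼γ₀(14)^{−d}A₁²p₀²(g₁) ≧ O(1)2(64)^dM^dL^{d+1}
R₁^{d+2}]. This condition is satisfied for p₀ large, and g₁ sufficiently small. Assume that the statement is true for
some j, and take a component Z of Z_{j+1}. We consider two cases. In the first case no large fields were introduced in
the last step, hence Z = S(Z₀), where Z₀ is a component of Z_j, and from the definition of κ_{j+1}(Z) we have κ_{j+1}(Z) =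
κ_j(Z₀) − O(1)M^dR_{j+1}^{d+1}d′_{j+1}(Z) (1.83) The equality Z = S(Z₀), and the inequality (1.80) holding for j and Z₀,
imply that this inequality holds for j+1 and Z. In this case we should consider also the domains Z such that Z = S(Z₀),
Z₀ satisfies the conditions (i), (ii), and a new large field was introduced in the preparatory operations. Then κ_j(Z₀)
≧ 0, and we do not have a better bound for it, but we have the new factor exp(−p₀(g_j)). We define κ_{j+1}(Z) = p₀(g_j) −
O(1)M^dR_{j+1}^{d+1}d′_{j+1}(Z). It satisfies (1.80), because Z is a small domain …, hence K = R_{j+1} for Z.»  p. 386: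
«In the second case Z is obtained from some number of components of Z_j, and some number of new large field regions,
joined together into the one component of Z_{j+1} … By the definition we have κ_{j+1}(Z) = Σ_n(κ_j(Z_j^{(n)}) +
2p₀(g_{j(Z_j^{(n)})})) + Σ_i(γ₀A₁²p₀²(g_{j+1})(d′_{j+1}(Z_{j+1}^{(i)}) + 1) + 2p₀(g_{j+1})) − O(1)M^dR_{j+1}^{d+1}d′_{j+1}(Z) −
2p₀(g_{j(Z)}). (1.85) We show that this number satisfies (1.80) by an induction with respect to the number of domains in
{Z_j^{(n)}, Z_{j+1}^{(i)}}. We have proved (1.80), if this number is equal to 1, because then we have either the situation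
covered by (1.83), or by the first induction step. … By (1.84) the graph G is connected. …»  p. 387: «… ≦ κ_{j+1}(Z),
(1.88) for p₀ large and γ small enough. This completes the inductive proof of the statement.  Let us draw some
conclusions from the statement. At first, the domain X in the definition (1.71) satisfies the assumption of the statement
with K = 0, therefore κ_k(X) ≧ 0, and we have the fundamental inequality 𝐓′_k(X)1 ≦ exp(−2(1+β₀)^{−1}p₀(g_k)). (1.89)»

WHAT THIS FILE PROVES (kernel-checked, zero `sorry`; `theorem`s plus the data-carrying declarations that RECORD the
printed case split — `structure`s `OldPiece` / `Birth` / `ResetPiece` / `MergeCase` / `Transition` / `Base`, `inductive`s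
`Piece` / `Case`, their projections, and the two sanity `def`s of §6 — no `def … : Prop` fact of Bałaban՚s is minted;
axioms standard; BY
NAME: `Step.Budget.{Controls, ScaleData, ScaleData.Invariant, merge, merge_eq_186, merge_step, base_182, case1_183,
reset_p386, controls_zero_iff, gconn_leaf, fundIneq189_of_budget}`, `Step.FundIneq189` — nothing re-proved; the
six-line leaf induction of `merge_controls` is RE-RUN over the subfamilies of the merging family (print՚s inner induction
ranges over sub-unions of Z՚s own pieces, and its single-domain base is needed for those pieces only)).
§1 **`controls_mono_κ`**, **`controls_iterate_cont`** — (1.80) is monotone in the budget; p. 384 «controls K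
   renormalization steps, under the assumption that no large fields are created in these steps» as the `m`-fold
   iterate of (1.83) (`case1_183`): after `m ≤ K` pure-continuation steps the budget, lowered by the `m` paid costs,
   controls the remaining `K − m` steps.
§2 THE SINGLE-DOMAIN CASES as data with their conclusions: `OldPiece` (continuation (1.83) of an old component with
   `K ≥ 1`: `OldPiece.controls` from the inductive hypothesis by `case1_183`), `Birth` («the first induction step» at a
   scale `m`: coefficient `a`, size `d′`, majorant (1.81) `hrhs`/`hcost` and the located condition `2Q ≤ a` of p. 385;
   `Birth.controls` by `base_182`), `ResetPiece` (p. 386: `hsmall` «because Z is a small domain»; `ResetPiece.controls`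
   by `reset_p386`).
§3 THE MERGER (1.85)–(1.88) as data: `MergeCase` — a finite family of pieces, each an `OldPiece` or a `Birth` at
   scale `j+1` (print՚s {Z_j^{(n)}, Z_{j+1}^{(i)}}), contribution `base x + P{x}` as in (1.85), a connectedness predicate
   with the endpoint property («By (1.84) the graph G is connected. Take a maximal tree graph …»), the binders `hP`
   («The index j(Z) is equal to one of the indices j(X), j(Y), hence …»), `hc` («Z is connected, and Z ⊂ X ∪ Y, hence
   d′(X) + d′(Y) + 2d ≧ d′(Z)»), `hsub` (p. 387 ll. 3–12, the sub-additivity of the (1.80)-sums with the absorption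
   overshoot `E`) and `hbudget` («for p₀ large and γ small enough») EXACTLY as in `merge_controls` /
   `merge_controls_conn` but asked of the subfamilies of the merging family only, and the
   identification of the family՚s cost/(1.80)-sum on single pieces with the pieces՚ own; **`MergeCase.controls`**: (1.80)
   at scale `j+1` for the merged component with `κ_{j+1}(Z)` = (1.85) (`Step.Budget.merge`), where the single-piece
   hypothesis `hsingle` of the inner induction is DISCHARGED — «either the situation covered by (1.83), or by the first
   induction step» — from the inductive hypothesis at scale `j` (`OldPiece.controls`) resp. `Birth.controls`.
§4 THE OUTER INDUCTION: `Case` (the four printed provenances of a component of Z_{j+1}) with **`Case.controls`**;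
   `Transition D D′` (every component of `Z_{j+1}` falls under a printed case, its horizon and size profile are the
   case՚s, its budget is at least the case՚s); **`invariant_succ`** : `D.Invariant b → Transition b D D′ → D′.Invariant b`
   (p. 385 «Assume that the statement is true for some j, and take a component Z of Z_{j+1} …» through p. 387 «This
   completes the inductive proof»); `Base`/**`invariant_base`** (p. 385, j = 1: every component of Z₁ is a first
   induction step); **`invariant_all`** : base at scale 1 + a transition at every scale ⇒ (1.80) for every component at
   every scale `j ≥ 1` — the row՚s inductive statement as ONE kernel theorem of the bookkeeping model.
§5 THE CONCLUSION p. 387: **`kappa_nonneg_of_invariant`** (a component with `K = 0` has `κ ≥ 0`, `controls_zero_iff`)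
   and **`fundIneq189_of_invariant`** ((1.89) `Step.FundIneq189` for such a component from the factor form of p. 384 and
   the profile slack, via `fundIneq189_of_budget` BY NAME).
§6 Non-vacuity: `contData` / `Transition.ofCont` (the pure-continuation transition of p. 384՚s «no large fields are
   created» inhabits `Transition`) and `invariant_contData`.
§7 (v1.1, append-only) THE MERGER IN INDEX FORM `MergeIndex`: regions of the cell՚s ℤᵈ index model with admissible tree graphs,
   G = the touch graph, (1.84) as `GConn`-connectedness, `d′_{j+1}` = tree length, `2p₀(g_{j(·)})` = `pFam` of the creation
   indices `Piece.jr` (old: `j(Z₀) ≤ j`; new: `j+1`), flow input (2.7a) `LogPowMono`; `hleaf`/`hne`/`hP`/`hc` DISCHARGED BY NAME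
   (`gconn_leaf`, `gconn_nonempty`, `hP_of_logPowMono`, `B16MergeGeometry.treeLen_fam_le`) — **`MergeIndex.controls`**: (1.80)
   for the merged component from the inductive hypothesis + (1.84) + (2.7a) + print՚s `hsub` + the located `hbudget` only.
§8 (v1.2, append-only) «THE FIRST INDUCTION STEP» IN THE INDEX MODEL: `Birth` INHABITED from the flow of [III] §2 and the ℤᵈ
   geometry of `S` BY NAME — for a non-empty face-connected region `Z` born at a scale `m` of a flow obeying (2.5)/(2.7)/(2.9a)
   and the located smallness of `B16SProfile`, the majorant (1.81) for the ACTUAL control range (`hrhs`, via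
   `B16CubeCurrency.card_majorant_181_and_stop_of_B14` ∘ `Step.Budget.sum_le_third_181` with the stopping rule «K ≦ n₀ − j + R_j»
   discharged by `B16StoppingRule.stopAt_threshold`) and the creation-cost bound (`hcost`, `Step.Budget.cost_le_third_181`) are
   theorems; what enters is print՚s located condition `hcond` ONLY (with the cell՚s constant `Q = 10·126^d·O(1)M^dL^{d+1}R_m^{d+2}`):
   **`exists_birth_ofIndex`**, **`controls_ofIndex`** ((1.80) at the creation scale for the (1.82)-budget), **`invariant_base_ofIndex`**
   (the base data of the outer induction for scale-`m` bookkeeping data read from index regions), `rhs180_le_new_ofIndex` (a new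
   piece of a merger).
§9 (v1.3, append-only) THE OUTER INDUCTION FROM AN INVARIANT AT THE FIRST SCALE and the index-model capstone: `invariant_all_of_invariant`
   (§4 with `(D j₀).Invariant` in place of `Base` data, so that §8՚s `invariant_base_ofIndex` feeds it by name), `fundIneq189_from_invariant`
   ((1.89) at every later scale), **`invariant_all_ofIndex`** / **`fundIneq189_ofIndex`** — (1.80) at every scale and (1.89) for every horizon-0 component FROM base data
   read from index regions (flow of [III] §2 + located condition + (1.82)) and a printed-case transition at every scale.
§10 (v1.4, append-only) THE RESET OF p. 386 IN THE INDEX MODEL: `ResetPiece` INHABITED — «because Z is a small domain, it is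
   contained in a cube of the size 100MR_{j+1}, hence K = R_{j+1} for Z»: for `Z₀` in an index box of radius `r₀ ≥ 22` (condition (i))
   every iterate of `Z = S(Z₀)` stays in a box of radius `r₀ + 10` (`Siter_subset_box_radInv`), so `K ≤ R_{j+1}` (`K_le_R_of_small`;
   `=` for a stopping index) and the costs of the `K + 1 ≤ 2R_{j+1}` steps are `≤ 2(2r₀+21)^d·O(1)M^{d_b}L^{d_b+1}R_{j+1}^{d_b+2}`
   (`sum_cost_le_of_small`): `hsmall` DISCHARGED under the located condition `hcondR` — **`exists_reset_ofIndex`**,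
   **`controls_reset_ofIndex`**; two size parameters (print: one `100`) record the index model՚s no-gain collar (HONEST SCOPE of §10).
HONEST SCOPE.  (a) Bookkeeping model: components are abstract (`ScaleData.Comp`), budgets/sizes/horizons are the data
print attaches to them; the GEOMETRY behind the binders (the profile bounds of (1.81), the stopping rule, (1.84), the
touching of X and Y, the absorption sentence of p. 387 ll. 12–15) is NOT proved here — it is carried as the same named
hypotheses the cited case lemmas carry (`hrhs`/`hcost`/`hcond`, `hsmall`, `hleaf`/`hP`/`hc`/`hsub`/`hbudget`), several of
which the cell discharged in its ℤᵈ index model (`B16SProfile`, `B16StoppingRule`, `B16MergeGeometry`,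
`B16MergeHorizon`) and one of which — print՚s uniform `hsub` — the cell showed NOT inhabitable along the printed route in
that model (`B16Absorption.no_uniform_absorption`; the cell՚s amortised substitute `StepInhabited` Part N is NOT
PRINTED and is not used here: this file follows the printed route, binders verbatim).  (b) Old pieces carry `K ≥ 1`
(they continue); an old component AT its horizon (`K = 0`) re-enters only through the p. 386 reset, as printed — print՚s
single-domain sentence «either … (1.83), or … the first induction step» names no third kind.  (c) The budgets of
`Z_{j+1}`՚s components enter as LOWER bounds by the case values ((1.82) is an inequality; (1.83)/(1.85)/p. 386 are
definitions, for which equality is the instance).  (d) Nothing here identifies the carriers with [III] §3 / [IV] §1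
regions; NOT summit progress.  The row՚s head stays at the owner՚s call.
-/

namespace Literature.MathematicalPhysics.QuantumFieldTheory.Balaban1983to89.B16Lem384Induction

open Literature.MathematicalPhysics.QuantumFieldTheory.Balaban1983to89
open Literature.MathematicalPhysics.QuantumFieldTheory.Balaban1983to89.Step
open Literature.MathematicalPhysics.QuantumFieldTheory.Balaban1983to89.Step.Budget

noncomputable section

/-! ## §1. (1.80) is monotone in the budget; «controls K renormalization steps» as the iterate of (1.83) -/

/-- (1.80) is monotone in the budget: a larger `κ_j(Z)` controls the same steps. [cite: Balaban1989LargeFieldII, (1.80) p.384] -/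
theorem controls_mono_κ (b : Budget.Consts) (j K : ℕ) {κ κ' : ℝ} (s : ℕ → ℝ) (h : Controls b j K κ s) (hκ : κ ≤ κ') :
    Controls b j K κ' s :=
  le_trans h hκ

/-- p. 384 «The factor exp(−κ_j(Z)) controls K renormalization steps, under the assumption that no large fields are
created in these steps»: the `m`-fold iterate of the continuation (1.83) — after `m ≤ K` steps in which the component only
continues (`Z ↦ S(Z)`, budget lowered by the paid cost `O(1)M^dR_n^{d+1}d′_n(S^{n−j}(Z))` of each step, p. 385 (1.83)), the
remaining budget controls the remaining `K − m` steps.  `case1_183` iterated. [cite: Balaban1989LargeFieldII, (1.80) p.384, (1.83) p.385] -/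
theorem controls_iterate_cont (b : Budget.Consts) (j K : ℕ) (κ : ℝ) (s : ℕ → ℝ) (h : Controls b j K κ s) :
    ∀ m, m ≤ K → Controls b (j + m) (K - m) (κ - ∑ n ∈ Finset.Ioc j (j + m), b.cost n (s n)) s := by
  intro m
  induction m with
  | zero =>
    intro _
    simpa using h
  | succ m ih =>
    intro hm
    have ih' := ih (by omega)
    have hK : 1 ≤ K - m := by omega
    have step := case1_183 b (j + m) (K - m) hK _ s ih'
    have e2 : K - m - 1 = K - (m + 1) := by omega
    have e3 : κ - ∑ n ∈ Finset.Ioc j (j + m), b.cost n (s n) - b.cost (j + m + 1) (s (j + m + 1)) =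
        κ - ∑ n ∈ Finset.Ioc j (j + m + 1), b.cost n (s n) := by
      have hsplit := Finset.sum_Ioc_consecutive (fun n => b.cost n (s n)) (Nat.le_add_right j m)
        (Nat.le_succ (j + m))
      rw [Nat.Ioc_succ_singleton, Finset.sum_singleton] at hsplit
      linarith
    rw [e3, e2] at step
    exact step

/-! ## §2. The single-domain cases of pp. 385–386 as data with their conclusions -/

/-- CASE 1, (1.83) p. 385 — the provenance «Z = S(Z₀), where Z₀ is a component of Z_j» of a component that CONTINUES:
an old component `Z₀` of the scale-`j` data which has at least one more controlled step (`1 ≤ K(Z₀)`; a component at its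
horizon re-enters only through the reset of p. 386, `ResetPiece`). [cite: Balaban1989LargeFieldII, (1.83) p.385] -/
structure OldPiece {j : ℕ} (D : ScaleData j) where
  Z₀ : D.Comp
  hK : 1 ≤ D.K Z₀

namespace OldPiece

variable {j : ℕ} {D : ScaleData j}

/-- (1.83): «κ_{j+1}(Z) = κ_j(Z₀) − O(1)M^dR_{j+1}^{d+1}d′_{j+1}(Z)», with `d′_{j+1}(Z) = d′_{j+1}(S(Z₀))` = the scale-`j+1`
entry of `Z₀`՚s size profile. [cite: Balaban1989LargeFieldII, (1.83) p.385] -/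
def κ' (b : Budget.Consts) (x : OldPiece D) : ℝ := D.κ x.Z₀ - b.cost (j + 1) (D.size x.Z₀ (j + 1))

/-- The horizon of `S(Z₀)` at scale `j+1`: one step fewer. [cite: Balaban1989LargeFieldII, (1.83) p.385] -/
def K' (x : OldPiece D) : ℕ := D.K x.Z₀ - 1

/-- The size profile of `S(Z₀)`: the `S`-iterates of `S(Z₀)` are those of `Z₀` («The equality Z = S(Z₀) …»). [cite: Balaban1989LargeFieldII, (1.83) p.385] -/
def size' (x : OldPiece D) : ℕ → ℝ := D.size x.Z₀

/-- «The equality Z = S(Z₀), and the inequality (1.80) holding for j and Z₀, imply that this inequality holds for j+1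
and Z» — from the INDUCTIVE HYPOTHESIS at scale `j`, by `case1_183`. [cite: Balaban1989LargeFieldII, (1.83) p.385] -/
theorem controls (b : Budget.Consts) (x : OldPiece D) (hD : D.Invariant b) :
    Controls b (j + 1) x.K' (x.κ' b) x.size' :=
  case1_183 b j (D.K x.Z₀) x.hK (D.κ x.Z₀) (D.size x.Z₀) (hD x.Z₀)

end OldPiece

/-- «THE FIRST INDUCTION STEP» at a scale `m` (p. 385 for `m = 1`; invoked at `m = j+1` for a lone new large field region on
p. 386): the data of a region BORN at scale `m` — the coefficient `a` of its fresh bracket `a·(d′_m + 1)` ((1.82):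
`a = ¼γ₀(14)^{−d}A₁²p₀²(g₁)`; (1.85): `γ₀A₁²p₀²(g_{j+1})`), its size `d′ = d′_m(·) ≥ 0`, the size profile of its
`S`-iterates, its horizon `K`, and IN THE CURRENCY OF `Step.Budget.base_182`: the majorant (1.81) `RHS(1.80) ≤ Q(d′+1)`
(`hrhs`), the same bound for the subtracted cost (`hcost`) and the LOCATED CONDITION «¼γ₀(14)^{−d}A₁²p₀²(g₁) ≧
O(1)2(64)^dM^dL^{d+1}R₁^{d+2}» (`hcond : 2Q ≤ a`; «satisfied for p₀ large, and g₁ sufficiently small»). [cite: Balaban1989LargeFieldII, (1.81)–(1.82) p.385] -/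
structure Birth (b : Budget.Consts) (m : ℕ) where
  a : ℝ
  d' : ℝ
  hd' : 0 ≤ d'
  size : ℕ → ℝ
  K : ℕ
  Q : ℝ
  hrhs : ∑ n ∈ Finset.Ioc m (m + K), b.cost n (size n) ≤ Q * (d' + 1)
  hcost : b.cost m d' ≤ Q * (d' + 1)
  hcond : 2 * Q ≤ a

namespace Birth

variable {b : Budget.Consts} {m : ℕ}

/-- The budget the first induction step certifies: the fresh bracket minus the creation-scale cost,
`a(d′+1) − O(1)M^dR_m^{d+1}d′` (the right-hand side of (1.82)). [cite: Balaban1989LargeFieldII, (1.82) p.385] -/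
def κ' (x : Birth b m) : ℝ := x.a * (x.d' + 1) - b.cost m x.d'

/-- «Thus, by the estimate (1.81), the statement holds for j = 1 … if [the located condition]» — (1.80) at the creation
scale for the certified budget, by `base_182`. [cite: Balaban1989LargeFieldII, (1.82) p.385] -/
theorem controls (x : Birth b m) : Controls b m x.K x.κ' x.size :=
  base_182 x.κ' x.a x.Q (b.cost m x.d') _ x.d' x.hd' le_rfl x.hrhs x.hcost x.hcond

end Birth

/-- THE RESET of p. 386: «Z = S(Z₀), Z₀ satisfies the conditions (i), (ii), and a new large field was introduced in the
preparatory operations. Then κ_j(Z₀) ≧ 0, … but we have the new factor exp(−p₀(g_j)). We define κ_{j+1}(Z) = p₀(g_j) −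
O(1)M^dR_{j+1}^{d+1}d′_{j+1}(Z). It satisfies (1.80), because Z is a small domain, it is contained in a cube of the size
100MR_{j+1}, hence K = R_{j+1} for Z» — provenance `Z₀` at its horizon (`K(Z₀) = 0`, recorded, not used by the
arithmetic), the fresh `p = p₀(g_j)`, the size profile and horizon of `Z`, and the located smallness `hsmall` of
`Step.Budget.reset_p386` (the fresh factor pays the small domain՚s costs). [cite: Balaban1989LargeFieldII, §1 p.386] -/
structure ResetPiece (b : Budget.Consts) {j : ℕ} (D : ScaleData j) where
  Z₀ : D.Comp
  hK0 : D.K Z₀ = 0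
  p : ℝ
  size : ℕ → ℝ
  K : ℕ
  hsmall : ∑ n ∈ Finset.Ioc j (j + 1 + K), b.cost n (size n) ≤ p

namespace ResetPiece

variable {b : Budget.Consts} {j : ℕ} {D : ScaleData j}

/-- «κ_{j+1}(Z) = p₀(g_j) − O(1)M^dR_{j+1}^{d+1}d′_{j+1}(Z)». [cite: Balaban1989LargeFieldII, §1 p.386] -/
def κ' (r : ResetPiece b D) : ℝ := r.p - b.cost (j + 1) (r.size (j + 1))

/-- «It satisfies (1.80)» — by `reset_p386`. [cite: Balaban1989LargeFieldII, §1 p.386] -/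
theorem controls (r : ResetPiece b D) : Controls b (j + 1) r.K r.κ' r.size :=
  reset_p386 b j r.K r.p r.size r.hsmall

end ResetPiece

/-! ## §3. The merger (1.85)–(1.88) as data; `hsingle` discharged from the inductive hypothesis -/

/-- A PIECE of a merger at scale `j+1` (p. 386 «Denote the components of Z_j by Z_j^{(n)}, and the new large field regions
by Z_{j+1}^{(i)}»): an old component continuing (with its (1.83) data) or a region born at scale `j+1` (with its
first-induction-step data). [cite: Balaban1989LargeFieldII, (1.85) p.386] -/
inductive Piece (b : Budget.Consts) {j : ℕ} (D : ScaleData j)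
  | old (x : OldPiece D)
  | new (x : Birth b (j + 1))

namespace Piece

variable {b : Budget.Consts} {j : ℕ} {D : ScaleData j}

/-- The bracket a piece contributes to (1.85) WITHOUT its `2p₀`-term: «κ_j(Z_j^{(n)})» for an old component,
«γ₀A₁²p₀²(g_{j+1})(d′_{j+1}(Z_{j+1}^{(i)}) + 1)» for a new region. [cite: Balaban1989LargeFieldII, (1.85) p.386] -/
def base : Piece b D → ℝ
  | old x => D.κ x.Z₀
  | new x => x.a * (x.d' + 1)

/-- The piece՚s own size at scale `j+1`, `d′_{j+1}(X)` (the argument of «O(1)M^dR_{j+1}^{d+1}d′_{j+1}(X)» in (1.86)). [cite: Balaban1989LargeFieldII, (1.86) p.386] -/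
def d1 : Piece b D → ℝ
  | old x => D.size x.Z₀ (j + 1)
  | new x => x.d'

/-- The piece՚s own horizon at scale `j+1`. [cite: Balaban1989LargeFieldII, (1.80) p.384] -/
def K : Piece b D → ℕ
  | old x => x.K'
  | new x => x.K

/-- The size profile of the piece՚s own `S`-iterates. [cite: Balaban1989LargeFieldII, (1.80) p.384] -/
def size : Piece b D → ℕ → ℝ
  | old x => x.size'
  | new x => x.size

/-- The piece՚s own (1.80)-sum at scale `j+1`: `Σ_{n=j+2}^{j+1+K(X)} O(1)M^dR_n^{d+1}d′_n(S^{n−j−1}(X))`. [cite: Balaban1989LargeFieldII, (1.80) p.384] -/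
def rhs180 (b : Budget.Consts) (x : Piece b D) : ℝ :=
  ∑ n ∈ Finset.Ioc (j + 1) (j + 1 + x.K), b.cost n (x.size n)

/-- «The statement (1.80) holds also for X and κ_{j+1}(X), because there is the exactly one domain in X» — «either the
situation covered by (1.83), or by the first induction step»: for every single piece, its own (1.80)-sum is at most its
bracket minus its cost, from the INDUCTIVE HYPOTHESIS at scale `j` (old) resp. `base_182` (new). [cite: Balaban1989LargeFieldII, p.386] -/
theorem rhs180_le (x : Piece b D) (hD : D.Invariant b) : x.rhs180 b ≤ x.base - b.cost (j + 1) x.d1 := by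
  cases x with
  | old x => exact x.controls b hD
  | new x => exact x.controls

end Piece

/-- CASE 2, THE MERGER (1.85)–(1.88) pp. 386–387, as data over a finite family of pieces: «Z is obtained from some number
of components of Z_j, and some number of new large field regions, joined together into the one component of Z_{j+1}».
Over a piece type `ι` with decidable equality; fields: the family `S` (non-empty); the provenance `prov` of each
piece; the functions of subfamilies `Pf` («2p₀(g_{j(·)})», `j(·)` = the first creation index in the subfamily), `cost`
(«O(1)M^dR_{j+1}^{d+1}d′_{j+1}» of the union) and `rhs` (the (1.80)-sum at scale `j+1` of the union); a connectedness
predicate `Conn` with the ENDPOINT property `hleaf` («By (1.84) the graph G is connected. Take a maximal tree graph …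
endpoints …»; for the touch graph: `Step.Budget.gconn_leaf`, see `hleaf_of_gconn`) holding for `S` (`hconn`); the
binders of `Step.Budget.merge_controls` / b02՚s `B16MergeGeometry.merge_controls_conn` VERBATIM (connectivity-premised
`hc`) — `hP` («The index j(Z) is equal to one of the indices j(X), j(Y), hence 2p₀(g_{j(X)}) + 2p₀(g_{j(Y)}) −
2p₀(g_{j(Z)}) ≧ 2(1+β₀)^{−1}p₀(g_{j+1})», `q` = the right side), `hc` («The domain Z is connected, and Z ⊂ X ∪ Y,
hence» the cost inequality with `Dc = O(1)2dM^dR_{j+1}^{d+1}`), `hsub` (p. 387 ll. 3–12: the (1.80)-sum of `Z` against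
those of `X`, `Y` plus the overshoot `E = O(1)·(100M)^dR_{j+1}^{d+2}`-terms), `hbudget` («for p₀ large and γ small
enough»: `E + Dc ≤ q`) — each asked only of the SUBFAMILIES of `S` (print՚s inner induction runs over sub-unions of
Z՚s own pieces); the identification on SINGLE pieces of the family՚s cost and (1.80)-sum with the piece՚s own
(`hcost1`, `hrhs1`); and the TARGET: the merged component՚s horizon `K` and size profile `size`, whose (1.80)-sum is
the family՚s (`hrhsZ`). [cite: Balaban1989LargeFieldII, (1.85)–(1.88) pp.386–387] -/
structure MergeCase (b : Budget.Consts) {j : ℕ} (D : ScaleData j) (ι : Type) [DecidableEq ι] where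
  S : Finset ι
  hne : S.Nonempty
  prov : ι → Piece b D
  Pf : Finset ι → ℝ
  cost : Finset ι → ℝ
  rhs : Finset ι → ℝ
  Conn : Finset ι → Prop
  hconn : Conn S
  q : ℝ
  E : ℝ
  Dc : ℝ
  hleaf : ∀ T, T ⊆ S → Conn T → 2 ≤ T.card → ∃ x ∈ T, Conn (T.erase x)
  hP : ∀ T x, T ⊆ S → x ∈ T → 2 ≤ T.card → q ≤ Pf {x} + Pf (T.erase x) - Pf T
  hc : ∀ T x, T ⊆ S → x ∈ T → 2 ≤ T.card → Conn T → Conn (T.erase x) →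
    cost T ≤ cost {x} + cost (T.erase x) + Dc
  hsub : ∀ T x, T ⊆ S → x ∈ T → 2 ≤ T.card → Conn T → Conn (T.erase x) →
    rhs T ≤ rhs {x} + rhs (T.erase x) + E
  hbudget : E + Dc ≤ q
  hcost1 : ∀ x ∈ S, cost {x} = b.cost (j + 1) (prov x).d1
  hrhs1 : ∀ x ∈ S, rhs {x} = (prov x).rhs180 b
  K : ℕ
  size : ℕ → ℝ
  hrhsZ : ∑ n ∈ Finset.Ioc (j + 1) (j + 1 + K), b.cost n (size n) ≤ rhs S

namespace MergeCase

variable {b : Budget.Consts} {j : ℕ} {D : ScaleData j} {ι : Type} [DecidableEq ι]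

/-- The contribution of a piece to (1.85): its bracket plus its `2p₀(g_{j(·)})`-term. [cite: Balaban1989LargeFieldII, (1.85) p.386] -/
def contrib (M : MergeCase b D ι) (x : ι) : ℝ := (M.prov x).base + M.Pf {x}

/-- (1.85) VERBATIM as `Step.Budget.merge`: «κ_{j+1}(Z) = Σ_n(κ_j(Z_j^{(n)}) + 2p₀(g_{j(Z_j^{(n)})})) + Σ_i(γ₀A₁²p₀²(g_{j+1})
(d′_{j+1}(Z_{j+1}^{(i)}) + 1) + 2p₀(g_{j+1})) − O(1)M^dR_{j+1}^{d+1}d′_{j+1}(Z) − 2p₀(g_{j(Z)})». [cite: Balaban1989LargeFieldII, (1.85) p.386] -/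
def κ' (M : MergeCase b D ι) : ℝ := merge M.contrib M.S (M.cost M.S) (M.Pf M.S)

/-- «Take a maximal tree graph … endpoints … Remove the vertex …»: for the graph form `Conn := GConn G` of a symmetric
touch relation `G` the endpoint property is `Step.Budget.gconn_leaf` (on every subfamily). [cite: Balaban1989LargeFieldII, p.386] -/
theorem hleaf_of_gconn (G : SimpleGraph ι) (S : Finset ι) :
    ∀ T, T ⊆ S → GConn G T → 2 ≤ T.card → ∃ x ∈ T, GConn G (T.erase x) :=
  fun T _ hT h2 => gconn_leaf G T hT h2

/-- The inner induction on the number of domains (p. 386; `Step.Budget.merge_controls`՚ leaf induction, chain (1.86)–(1.88)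
by `merge_eq_186` / `merge_step`) RE-RUN OVER THE SUBFAMILIES of the merging family: print՚s induction ranges over
sub-unions of Z՚s own pieces, and its single-domain base `hsingle` is needed for those pieces only. [cite: Balaban1989LargeFieldII, (1.86)–(1.88) pp.386–387] -/
theorem rhs_le_merge_of_subset (M : MergeCase b D ι)
    (hsingle : ∀ x ∈ M.S, M.rhs {x} ≤ merge M.contrib {x} (M.cost {x}) (M.Pf {x})) :
    ∀ T, T ⊆ M.S → M.Conn T → T.Nonempty → M.rhs T ≤ merge M.contrib T (M.cost T) (M.Pf T) := by
  intro T
  induction T using Finset.strongInduction with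
  | H T ih =>
    intro hTS hconn hne
    by_cases h2 : 2 ≤ T.card
    · obtain ⟨x, hx, hconnY⟩ := M.hleaf T hTS hconn h2
      have hYne : (T.erase x).Nonempty := by
        rw [← Finset.card_pos, Finset.card_erase_of_mem hx]
        omega
      have hYS : T.erase x ⊆ M.S := (Finset.erase_subset x T).trans hTS
      have ihY := ih (T.erase x) (Finset.erase_ssubset hx) hYS hconnY hYne
      exact merge_step _ _ _ _ _ _ _ _ _ _ _ _ M.q M.E M.Dc
        (merge_eq_186 M.contrib T x hx (M.cost T) (M.Pf T) (M.cost {x}) (M.Pf {x}) (M.cost (T.erase x))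
          (M.Pf (T.erase x)))
        (M.hP T x hTS hx h2) (M.hc T x hTS hx h2 hconn hconnY) (M.hsub T x hTS hx h2 hconn hconnY)
        (hsingle x (hTS hx)) ihY M.hbudget
    · have hcard : T.card = 1 := by have := Finset.card_pos.mpr hne; omega
      obtain ⟨y, rfl⟩ := Finset.card_eq_one.mp hcard
      exact hsingle y (hTS (Finset.mem_singleton_self y))

/-- `hsingle` DISCHARGED: «We have proved (1.80), if this number is equal to 1, because then we have either the situation
covered by (1.83), or by the first induction step» — for every piece of the family, from the inductive hypothesis at
scale `j` / `base_182` (`Piece.rhs180_le`) and the single-piece identifications. [cite: Balaban1989LargeFieldII, p.386] -/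
theorem hsingle_of_invariant (M : MergeCase b D ι) (hD : D.Invariant b) :
    ∀ x ∈ M.S, M.rhs {x} ≤ merge M.contrib {x} (M.cost {x}) (M.Pf {x}) := by
  intro x hx
  have h := (M.prov x).rhs180_le hD
  rw [M.hrhs1 x hx]
  unfold merge contrib
  rw [Finset.sum_singleton, M.hcost1 x hx]
  linarith

/-- **CASE 2 CONCLUDED**: (1.80) at scale `j+1` for the merged component with the budget (1.85) — the inner induction on
the number of domains (the chain (1.86)–(1.88) of `merge_step`, run inside the family) with its single-domain
base supplied by the inductive hypothesis at scale `j`. [cite: Balaban1989LargeFieldII, (1.85)–(1.88) pp.386–387] -/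
theorem controls (M : MergeCase b D ι) (hD : D.Invariant b) : Controls b (j + 1) M.K M.κ' M.size := by
  have h := M.rhs_le_merge_of_subset (M.hsingle_of_invariant hD) M.S le_rfl M.hconn M.hne
  unfold Controls
  exact le_trans M.hrhsZ h

end MergeCase

/-! ## §4. The outer induction on `j` -/

/-- THE PRINTED CASE SPLIT for ONE component of `Z_{j+1}` (p. 385 «We consider two cases» + the reset clause + p. 386 «In
the second case …»): continuation (1.83), reset (p. 386), a lone new region («the first induction step»), or a merger
(1.85). [cite: Balaban1989LargeFieldII, pp.385–386] -/
inductive Case (b : Budget.Consts) {j : ℕ} (D : ScaleData j)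
  | cont (x : OldPiece D)
  | reset (r : ResetPiece b D)
  | born (x : Birth b (j + 1))
  | merge {ι : Type} [DecidableEq ι] (M : MergeCase b D ι)

namespace Case

variable {b : Budget.Consts} {j : ℕ} {D : ScaleData j}

/-- The horizon the case assigns. [cite: Balaban1989LargeFieldII, pp.385–386] -/
def K : Case b D → ℕ
  | cont x => x.K'
  | reset r => r.K
  | born x => x.K
  | merge M => M.K

/-- The budget the case certifies ((1.83) / p. 386 / the fresh bracket minus cost / (1.85)). [cite: Balaban1989LargeFieldII, pp.385–386] -/
def κ : Case b D → ℝ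
  | cont x => x.κ' b
  | reset r => r.κ'
  | born x => x.κ'
  | merge M => M.κ'

/-- The size profile the case assigns. [cite: Balaban1989LargeFieldII, pp.385–386] -/
def size : Case b D → ℕ → ℝ
  | cont x => x.size'
  | reset r => r.size
  | born x => x.size
  | merge M => M.size

/-- EVERY PRINTED CASE YIELDS (1.80) AT SCALE `j+1`, given the inductive hypothesis at scale `j`. [cite: Balaban1989LargeFieldII, pp.385–387] -/
theorem controls (c : Case b D) (hD : D.Invariant b) : Controls b (j + 1) c.K c.κ c.size := by
  cases c with
  | cont x => exact x.controls b hD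
  | reset r => exact r.controls
  | born x => exact x.controls
  | merge M => exact M.controls hD

end Case

/-- A TRANSITION `j → j+1` of the bookkeeping data (p. 385 «take a component Z of Z_{j+1}»): every component of `Z_{j+1}`
falls under one of the printed cases, its horizon and size profile are the ones the case assigns, and its budget
`κ_{j+1}(Z)` is at least the value the case certifies. [cite: Balaban1989LargeFieldII, pp.385–386] -/
structure Transition (b : Budget.Consts) {j : ℕ} (D : ScaleData j) (D' : ScaleData (j + 1)) where
  case : D'.Comp → Case b D
  hK : ∀ Z, D'.K Z = (case Z).K
  hsize : ∀ Z, D'.size Z = (case Z).size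
  hκ : ∀ Z, (case Z).κ ≤ D'.κ Z

/-- **THE INDUCTIVE STEP** (p. 385 «Assume that the statement is true for some j, and take a component Z of Z_{j+1}» …
p. 387 «This completes the inductive proof of the statement»): (1.80) for every component at scale `j` and a printed-case
transition give (1.80) for every component at scale `j+1`. [cite: Balaban1989LargeFieldII, pp.385–387] -/
theorem invariant_succ (b : Budget.Consts) {j : ℕ} {D : ScaleData j} {D' : ScaleData (j + 1)} (hD : D.Invariant b)
    (T : Transition b D D') : D'.Invariant b := by
  intro Z
  rw [T.hK Z, T.hsize Z]
  exact controls_mono_κ b (j + 1) _ _ ((T.case Z).controls hD) (T.hκ Z)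

/-- THE BASE DATA at a scale `m` (p. 385, `m = 1`: «Take a component Z of the region Z₁. It is determined by some of the
large field regions …»): every component is a first induction step — its horizon/profile are the birth data՚s and its
budget is at least the certified one ((1.82) is the inequality «κ₁(Z) ≧ …»). [cite: Balaban1989LargeFieldII, (1.82) p.385] -/
structure Base (b : Budget.Consts) {m : ℕ} (D : ScaleData m) where
  birth : D.Comp → Birth b m
  hK : ∀ Z, D.K Z = (birth Z).K
  hsize : ∀ Z, D.size Z = (birth Z).size
  hκ : ∀ Z, (birth Z).κ' ≤ D.κ Z

/-- «Thus, by the estimate (1.81), the statement holds for j = 1» — (1.80) for every component from the base data. [cite: Balaban1989LargeFieldII, (1.82) p.385] -/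
theorem invariant_base (b : Budget.Consts) {m : ℕ} {D : ScaleData m} (B : Base b D) : D.Invariant b := by
  intro Z
  rw [B.hK Z, B.hsize Z]
  exact controls_mono_κ b m _ _ (B.birth Z).controls (B.hκ Z)

/-- **THE INDUCTIVE STATEMENT OF p. 384 FOR ALL SCALES** (row B16.Lem@384): given the bookkeeping data `D j` of every scale,
base data at scale `1` and a printed-case transition `j → j+1` at every scale `j ≥ 1`, (1.80) holds for every component of
every `Z_j`, `j ≥ 1` — «We prove this statement by an induction with respect to j». [cite: Balaban1989LargeFieldII, (1.80) p.384, proof pp.384–387] -/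
theorem invariant_all (b : Budget.Consts) (D : (j : ℕ) → ScaleData j) (B : Base b (D 1))
    (T : ∀ j, 1 ≤ j → Transition b (D j) (D (j + 1))) : ∀ j, 1 ≤ j → (D j).Invariant b := by
  intro j hj
  induction j with
  | zero => exact absurd hj (by omega)
  | succ j ih =>
    by_cases h0 : j = 0
    · subst h0
      exact invariant_base b B
    · exact invariant_succ b (ih (by omega)) (T j (by omega))

/-- The same from base data at an arbitrary first scale `j₀` (the induction does not use `j₀ = 1`). [cite: Balaban1989LargeFieldII, (1.80) p.384, proof pp.384–387] -/
theorem invariant_all_from (b : Budget.Consts) (D : (j : ℕ) → ScaleData j) (j₀ : ℕ) (B : Base b (D j₀))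
    (T : ∀ j, j₀ ≤ j → Transition b (D j) (D (j + 1))) : ∀ j, j₀ ≤ j → (D j).Invariant b := by
  intro j hj
  induction j with
  | zero =>
    have : j₀ = 0 := by omega
    subst this
    exact invariant_base b B
  | succ j ih =>
    by_cases h0 : j₀ = j + 1
    · subst h0
      exact invariant_base b B
    · exact invariant_succ b (ih (by omega)) (T j (by omega))

/-! ## §5. The conclusion of p. 387: `K = 0` ⇒ `κ_k(X) ≥ 0` ⇒ (1.89) -/

/-- p. 387 «At first, the domain X in the definition (1.71) satisfies the assumption of the statement with K = 0, therefore
κ_k(X) ≧ 0»: under (1.80) at scale `k`, a component with horizon `0` has a non-negative budget (`controls_zero_iff`). [cite: Balaban1989LargeFieldII, p.387] -/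
theorem kappa_nonneg_of_invariant (b : Budget.Consts) {k : ℕ} {D : ScaleData k} (hD : D.Invariant b) (X : D.Comp)
    (hK : D.K X = 0) : 0 ≤ D.κ X := by
  have h := hD X
  rw [hK] at h
  exact (controls_zero_iff b k (D.κ X) (D.size X)).mp h

/-- «… and we have the fundamental inequality 𝐓′_k(X)1 ≦ exp(−2(1+β₀)^{−1}p₀(g_k)). (1.89)» — `Step.FundIneq189` for such a
component, from (1.80) at scale `k` (this file), the factor form of p. 384 «we write the factor connected with Z in the
form exp(−κ_j(Z) − 2p₀(g_{j(Z)}))» (`hT`) and the profile slack «2p₀(g_{j(X)}) ≥ 2(1+β₀)⁻¹p₀(g_k)» (`hP`), by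
`fundIneq189_of_budget` BY NAME. [cite: Balaban1989LargeFieldII, (1.89) p.387] -/
theorem fundIneq189_of_invariant (b : Budget.Consts) {k : ℕ} {D : ScaleData k} (hD : D.Invariant b) (X : D.Comp)
    (hK : D.K X = 0) {V : Type*} (T1X : V → ℝ) (A₀ : ℝ) (p₀ : ℕ) (β₀ gk Pj : ℝ)
    (hT : ∀ v, T1X v ≤ Real.exp (-D.κ X - Pj)) (hP : 2 * (1 + β₀)⁻¹ * p0Profile A₀ p₀ gk ≤ Pj) :
    FundIneq189 T1X A₀ p₀ β₀ gk :=
  fundIneq189_of_budget T1X A₀ p₀ β₀ gk (D.κ X) Pj hT (kappa_nonneg_of_invariant b hD X hK) hP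

/-- (1.80) at every scale and (1.89) for every horizon-`0` component at every scale `k ≥ 1`, from base data and
transitions — §4 ∘ §5. [cite: Balaban1989LargeFieldII, (1.80) p.384, (1.89) p.387] -/
theorem fundIneq189_of_history (b : Budget.Consts) (D : (j : ℕ) → ScaleData j) (B : Base b (D 1))
    (T : ∀ j, 1 ≤ j → Transition b (D j) (D (j + 1))) {k : ℕ} (hk : 1 ≤ k) (X : (D k).Comp) (hK : (D k).K X = 0)
    {V : Type*} (T1X : V → ℝ) (A₀ : ℝ) (p₀ : ℕ) (β₀ gk Pj : ℝ)
    (hT : ∀ v, T1X v ≤ Real.exp (-(D k).κ X - Pj)) (hP : 2 * (1 + β₀)⁻¹ * p0Profile A₀ p₀ gk ≤ Pj) :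
    FundIneq189 T1X A₀ p₀ β₀ gk :=
  fundIneq189_of_invariant b (invariant_all b D B T k hk) X hK T1X A₀ p₀ β₀ gk Pj hT hP

/-! ## §6. Non-vacuity: the pure-continuation transition of p. 384 inhabits `Transition` -/

/-- The scale-`j+1` data in which EVERY component continues (p. 384 «under the assumption that no large fields are created
in these steps»; requires every horizon `≥ 1`): same components, creation indices, size profiles; horizons lowered by one;
budgets lowered by the paid cost (1.83). [cite: Balaban1989LargeFieldII, (1.83) p.385] -/
def contData (b : Budget.Consts) {j : ℕ} (D : ScaleData j) (hK : ∀ Z, 1 ≤ D.K Z) : ScaleData (j + 1) where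
  Comp := D.Comp
  jZ := D.jZ
  jZ_le := fun Z => Nat.le_succ_of_le (D.jZ_le Z)
  κ := fun Z => (OldPiece.mk Z (hK Z)).κ' b
  size := D.size
  K := fun Z => D.K Z - 1

/-- The pure-continuation transition: every component of `contData` is the case (1.83) of itself. [cite: Balaban1989LargeFieldII, (1.83) p.385] -/
def Transition.ofCont (b : Budget.Consts) {j : ℕ} (D : ScaleData j) (hK : ∀ Z, 1 ≤ D.K Z) :
    Transition b D (contData b D hK) where
  case := fun Z => Case.cont (OldPiece.mk Z (hK Z))
  hK := fun _ => rfl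
  hsize := fun _ => rfl
  hκ := fun _ => le_rfl

/-- (1.80) survives the pure-continuation step (an instance of `invariant_succ`; = `case1_183` componentwise). [cite: Balaban1989LargeFieldII, (1.83) p.385] -/
theorem invariant_contData (b : Budget.Consts) {j : ℕ} (D : ScaleData j) (hK : ∀ Z, 1 ≤ D.K Z) (hD : D.Invariant b) :
    (contData b D hK).Invariant b :=
  invariant_succ b hD (Transition.ofCont b D hK)

/-! ## §7 (v1.1). The merger with `hleaf`, `hP`, `hc` DISCHARGED BY NAME (touch graph of cube regions, creation indices,
the cell՚s tree-length geometry): what remains are print՚s two implicit inputs `hsub` (p. 387 ll. 3–12) and `hbudget`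

APPEND-ONLY addition (r13 gen 18, v1.1): nothing above is changed; one `import` (`B16MergeGeometry`, which imports `Step`) is
added.  BY NAME: `Step.Budget.{gconn_leaf, gconn_nonempty, pFam, LogPowMono, hP_of_logPowMono, Consts.cost_add,
Consts.cost_mono}` (cell unit f2, `Step` Parts F4/F5) and `B16MergeGeometry.{touchGraph, fam, fam_singleton, treeLen_fam_le}`
(cell unit b02) — nothing re-proved. -/

namespace Piece

variable {b : Budget.Consts} {j : ℕ} {D : ScaleData j}

/-- THE CREATION INDEX of a piece (p. 384 «j(Z) is the index of a first large field region contained in Z»; p. 386 «The index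
j(Z) is equal to one of the indices j(X), j(Y)»): an old component keeps its `j(Z₀) ≤ j` (`ScaleData.jZ`), a new region is
created at `j+1`. [cite: Balaban1989LargeFieldII, p.384, p.386] -/
def jr : Piece b D → ℕ
  | old x => D.jZ x.Z₀
  | new _ => j + 1

/-- Every piece of a merger at scale `j+1` was created at an index `≤ j+1` (the input `hjr` of
`Step.Budget.hP_of_logPowMono`). [cite: Balaban1989LargeFieldII, p.386] -/
theorem jr_le (x : Piece b D) : x.jr ≤ j + 1 := by
  cases x with
  | old x => exact Nat.le_succ_of_le (D.jZ_le x.Z₀)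
  | new x => exact le_rfl

end Piece

open Literature.MathematicalPhysics.QuantumFieldTheory.Balaban1983to89.B13ScaleTransfer
open Literature.MathematicalPhysics.QuantumFieldTheory.Balaban1983to89.TreeLength
open Literature.MathematicalPhysics.QuantumFieldTheory.Balaban1983to89.B16MergeGeometry

/-- THE MERGER IN INDEX FORM: the pieces carry REGIONS `P x ⊆ ℤᵈ` of the cell՚s index model (p. 386 (1.84): the domains
`(Z_j^{(n)})′^{~10}`, `(Z_{j+1}^{(i)})^{~2}` as sets of `MR_{j+1}`-cube indices, each with an admissible tree graph), the graph
G of p. 386 IS the touch graph of the regions («a pair of domains is a line in G if … the corresponding domains intersect, or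
touch each other») and «By (1.84) the graph G is connected» is the hypothesis `hconn`; the size `d′_{j+1}` of a piece is the
tree length of its region (`hsize1`), the cost of a sub-union is `O(1)M^dR_{j+1}^{d+1}·d′_{j+1}(⋃ T)` (`Step.Budget.Consts.cost`
of `treeLen (fam P T)`), the `2p₀(g_{j(·)})`-terms are `Step.Budget.pFam` of the creation indices `Piece.jr`, and the flow input
(2.7a) [III] «(log g_n^{−2})^p ≦ (1+β₀)(log g_m^{−2})^p» is `Step.Budget.LogPowMono` (`h27`; the first member of `B14.FlowIneq27`).
REMAINING named inputs: the (1.80)-sums `rhs` with print՚s sub-additivity + absorption overshoot `hsub` (p. 387 ll. 3–12, per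
subfamily, connectivity-premised) and the located condition `hbudget` («for p₀ large and γ small enough»:
`E + O(1)M^dR_{j+1}^{d+1}·2 ≤ 2(1+β₀)⁻¹p₀(g_{j+1})` — the cell՚s sup-metric tree-length model has `+2` where print՚s Euclidean
count has `+2d`), the single-piece identification `hrhs1`, the merged component՚s horizon/profile with `hrhsZ`, and the signs of
the cost constants. [cite: Balaban1989LargeFieldII, (1.84)–(1.88) pp.386–387] -/
structure MergeIndex (b : Budget.Consts) {j : ℕ} (D : ScaleData j) (ι : Type) [DecidableEq ι] (d : ℕ) where
  S : Finset ι
  prov : ι → Piece b D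
  P : ι → Finset (Pt d)
  hadm : ∀ i, ∃ T, Admissible (P i) T
  hconn : GConn (touchGraph P) S
  hsize1 : ∀ x ∈ S, treeLen (P x) = (prov x).d1
  rhs : Finset ι → ℝ
  hrhs1 : ∀ x ∈ S, rhs {x} = (prov x).rhs180 b
  A₀ : ℝ
  β₀ : ℝ
  p₀ : ℕ
  Kf : ℕ
  g : ℕ → ℝ
  hA : 0 ≤ A₀
  hβ₀ : 0 ≤ β₀
  h27 : LogPowMono g β₀ p₀ Kf
  hjK : j + 1 ≤ Kf
  hnn : 0 ≤ p0Profile A₀ p₀ (g (j + 1))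
  E : ℝ
  hsub : ∀ T x, T ⊆ S → x ∈ T → 2 ≤ T.card → GConn (touchGraph P) T → GConn (touchGraph P) (T.erase x) →
    rhs T ≤ rhs {x} + rhs (T.erase x) + E
  hC : 0 ≤ b.C
  hM : 0 ≤ b.M
  hR : 0 ≤ b.R (j + 1)
  hbudget : E + b.cost (j + 1) 2 ≤ 2 * (1 + β₀)⁻¹ * p0Profile A₀ p₀ (g (j + 1))
  K : ℕ
  size : ℕ → ℝ
  hrhsZ : ∑ n ∈ Finset.Ioc (j + 1) (j + 1 + K), b.cost n (size n) ≤ rhs S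

namespace MergeIndex

variable {b : Budget.Consts} {j : ℕ} {D : ScaleData j} {ι : Type} [DecidableEq ι] {d : ℕ}

/-- The cost of a sub-union: `O(1)M^dR_{j+1}^{d+1}·d′_{j+1}(⋃_{x∈T} P x)` with the cell՚s tree length for `d′`. [cite: Balaban1989LargeFieldII, (1.86) p.386] -/
def cost (M : MergeIndex b D ι d) (T : Finset ι) : ℝ := b.cost (j + 1) (treeLen (fam M.P T))

/-- «The domain Z is connected, and Z ⊂ X ∪ Y, hence d′_{j+1}(X) + d′_{j+1}(Y) + 2d ≧ d′_{j+1}(Z)» — the cost binder `hc` of the inner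
induction DISCHARGED in the cell՚s model by `B16MergeGeometry.treeLen_fam_le` (`+2` join cost), in cost currency by
`Consts.cost_mono` / `Consts.cost_add`. [cite: Balaban1989LargeFieldII, after (1.86) p.386–387] -/
theorem hc (M : MergeIndex b D ι d) : ∀ T x, T ⊆ M.S → x ∈ T → 2 ≤ T.card → GConn (touchGraph M.P) T →
    GConn (touchGraph M.P) (T.erase x) → M.cost T ≤ M.cost {x} + M.cost (T.erase x) + b.cost (j + 1) 2 := by
  intro T x _ hx h2 hT hY
  have h := treeLen_fam_le M.hadm hx h2 hT hY
  unfold cost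
  rw [fam_singleton, ← Consts.cost_add, ← Consts.cost_add]
  exact Consts.cost_mono b (j + 1) M.hC M.hM M.hR h

/-- THE INDEX-FORM MERGER AS A `MergeCase`: `Conn := GConn (touchGraph P)` with `hleaf := gconn_leaf` and `hne := gconn_nonempty`,
`Pf := pFam A₀ p₀ g (j(·))` with `hP := hP_of_logPowMono` (creation indices `Piece.jr ≤ j+1`), `cost` with `hc` from
`treeLen_fam_le`, `q := 2(1+β₀)⁻¹p₀(g_{j+1})`, `Dc := O(1)M^dR_{j+1}^{d+1}·2`. [cite: Balaban1989LargeFieldII, (1.84)–(1.88) pp.386–387] -/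
def toMergeCase (M : MergeIndex b D ι d) : MergeCase b D ι where
  S := M.S
  hne := gconn_nonempty (touchGraph M.P) M.S M.hconn
  prov := M.prov
  Pf := pFam M.A₀ M.p₀ M.g (fun x => (M.prov x).jr)
  cost := M.cost
  rhs := M.rhs
  Conn := GConn (touchGraph M.P)
  hconn := M.hconn
  q := 2 * (1 + M.β₀)⁻¹ * p0Profile M.A₀ M.p₀ (M.g (j + 1))
  E := M.E
  Dc := b.cost (j + 1) 2
  hleaf := MergeCase.hleaf_of_gconn (touchGraph M.P) M.S
  hP := fun T x _ hx h2 =>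
    hP_of_logPowMono M.A₀ M.β₀ M.p₀ M.Kf j M.g (fun x => (M.prov x).jr) M.hA M.hβ₀ M.h27 M.hjK M.hnn
      (fun y => (M.prov y).jr_le) T x hx h2
  hc := M.hc
  hsub := M.hsub
  hbudget := M.hbudget
  hcost1 := fun x hx => by
    show b.cost (j + 1) (treeLen (fam M.P {x})) = b.cost (j + 1) (M.prov x).d1
    rw [fam_singleton, M.hsize1 x hx]
  hrhs1 := M.hrhs1
  K := M.K
  size := M.size
  hrhsZ := M.hrhsZ

/-- **CASE 2 IN INDEX FORM CONCLUDED**: (1.80) at scale `j+1` for the merged component with the budget (1.85) (`pFam` terms,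
tree-length costs), from the inductive hypothesis at scale `j`, the touch-graph connectedness (1.84), the flow input (2.7a),
print՚s `hsub` and the located `hbudget` — `hleaf`/`hP`/`hc`/`hsingle` all discharged. [cite: Balaban1989LargeFieldII, (1.84)–(1.88) pp.386–387] -/
theorem controls (M : MergeIndex b D ι d) (hD : D.Invariant b) :
    Controls b (j + 1) M.K M.toMergeCase.κ' M.size :=
  M.toMergeCase.controls hD

/-- The index-form merger as a printed `Case` of the outer induction (for `Transition.case`). [cite: Balaban1989LargeFieldII, pp.385–387] -/
def toCase (M : MergeIndex b D ι d) : Case b D := Case.merge M.toMergeCase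

/-- Its case data: horizon, budget (1.85), profile. [cite: Balaban1989LargeFieldII, (1.85) p.386] -/
theorem toCase_K (M : MergeIndex b D ι d) : M.toCase.K = M.K := rfl

/-- (see `toCase_K`) [cite: Balaban1989LargeFieldII, (1.85) p.386] -/
theorem toCase_κ (M : MergeIndex b D ι d) : M.toCase.κ = M.toMergeCase.κ' := rfl

/-- (see `toCase_K`) [cite: Balaban1989LargeFieldII, (1.85) p.386] -/
theorem toCase_size (M : MergeIndex b D ι d) : M.toCase.size = M.size := rfl

end MergeIndex

/-! ## §8 (v1.2). «The first induction step» IN THE INDEX MODEL: `Birth` inhabited from the flow of [III] §2 and the ℤᵈ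
geometry of the operation `S` BY NAME — (1.81) ⇒ (1.80) at the creation scale with `hrhs`/`hcost` DISCHARGED

APPEND-ONLY addition (r13 gen 19, v1.2): nothing above is changed; one `import` (`B16CubeCurrency`, cell unit b02 gen 12,
which imports `B16MergeHorizon` → `B16StoppingRule`/`B16SProfile` → `StepInhabited`) is added.  THE PRINT (p. 385 [PDF 31], in
print order; v1.3 docfix of the quotation order, r16 addendum 16): ll. 2–6 «Consider now the sum in (1.80). Let n₀ be the last index n
such that d′_n(Z^{(n−j)}) > 0. Then S^{n₀+1−j}(Z) is contained in a cube of the size 64MR_{n₀+1}, hence it satisfies the condition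
(i), and doing at most R_j further steps we obtain a domain satisfying both conditions (i), (ii). Thus K ≦ n₀ − j + R_j, and we have
Σ_{n=j+1}^{j+K} O(1)M^dR_n^{d+1}d′_n(S^{n−j}(Z)) ≦ … ≦ O(1)(64)^dM^dL^{d+1}R_j^{d+2}(d′_j(Z) + 1). (1.81)»; then l. 7 ff. «Now we prove
the statement for j = 1. Take a component Z of the region Z₁. … From the definition of κ₁(Z) we get the following bound: … (1.82)
Thus, by the estimate (1.81), the statement holds for j = 1, i.e., the inequality (1.80) holds for j = 1, if ¼γ₀(14)^{−d}A₁²p₀²(g₁)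
≧ O(1)2(64)^dM^dL^{d+1}R₁^{d+2}. This condition is satisfied for p₀ large, and g₁ sufficiently small.»  WHAT §2՚s `Birth` asked as
data — the majorant `hrhs : RHS(1.80) ≤ Q(d′+1)` over the ACTUAL control range and the creation-cost bound `hcost` — is here
SUPPLIED BY NAME for a region of the cell՚s ℤᵈ index model: `B16CubeCurrency.card_majorant_181_and_stop_of_B14` (the
canonical flow `R_n = L^{σ_n}`, `σ_n = log_L R_n`, of [III] (2.5); the threshold scale `n₀`; (1.81) second-to-third for every
tail in tree-length currency from `B16SProfile.profile_h1`/`profile_h2` under the drop control derived from (2.7)/(2.9a) and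
the located smallness `(1 + g_n²β′(n−m))^{β₀} ≦ L^{⌊max(n−m,2)/2⌋}`; the stopping property at `n₀ − m + R_m` by
`B16StoppingRule.stopAt_threshold`), `Step.Budget.sum_le_third_181` (the seam to the actual range with the ONE binder
`hstop : m + K ≤ n₀ + R_m`, discharged below) and `Step.Budget.cost_le_third_181` (cell unit f2, `StepInhabited` Part M).
WHAT ENTERS: print՚s located condition `hcond : 2Q ≤ a` ONLY, with the cell՚s repaired constant `Q = A′·O(1)M^{d_b}L^{d_b+1}
R_m^{d_b+2}`, `A′ = 10·126^d` (print: `O(1)(64)^d…R_1^{d+2}`; `d` = the lattice dimension of `Pt d`, `d_b = b.d` the cost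
exponent), the flow hypotheses verbatim as in `B16CubeCurrency`/`B16StoppingRule`, the cleanliness predicate of condition (ii)
holding after the creation scale (p. 384 «under the assumption that no large fields are created in these steps»), and THE
HORIZON `K` as any number of steps inside the flow horizon NOT EXCEEDING A STOPPING INDEX (inclusive reading of (ii), memory
`N = R_m`, size parameter `Nsz ≥ 64` — print `100`): print՚s «smallest positive integer having the property …» is the case
`K = Nat.find`, and a flow ending before the stopping scale is the case `K = K_f − m` (`B16StoppingRule`, WHAT IS NOT CLAIMED
(b)); (1.80) for a smaller `K` is weaker, so both are covered.  NOT CLAIMED: the identification of the index model with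
print՚s domains (cell D-b02g9.1); the value of `O(1)`; anything about `hcond` beyond its being the printed condition with the
cell՚s constant. -/

open Literature.MathematicalPhysics.QuantumFieldTheory.Balaban1983to89.B16SProfile
open Literature.MathematicalPhysics.QuantumFieldTheory.Balaban1983to89.B16StoppingRule
open Literature.MathematicalPhysics.QuantumFieldTheory.Balaban1983to89.B16CubeCurrency

variable {d : ℕ}

/-- THE STOPPING RULE «Thus K ≦ n₀ − j + R_j» AS THE BINDER `hstop` OF `Step.Budget.sum_le_third_181`, for ANY horizon `K`
inside the flow horizon (`m + K ≤ K_f`) that does not exceed a stopping index: if the threshold scale leaves room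
(`n₀ + R_m ≤ K_f`) the stopping property holds at `n₀ − m + R_m` (`hstopAt`, = `B16StoppingRule.stopAt_threshold`), so
`K ≤ n₀ − m + R_m`; otherwise `m + K ≤ K_f < n₀ + R_m`. [cite: Balaban1989LargeFieldII, p.385 l.5 (K ≤ n₀ − j + R_j)] -/
theorem hstop_of_min {m K Kf n₀ Rm : ℕ} (hmn₀ : m ≤ n₀) (hmK : m + K ≤ Kf) {P : ℕ → Prop}
    (hstopAt : n₀ + Rm ≤ Kf → P (n₀ - m + Rm)) (hKmin : ∀ K', P K' → K ≤ K') : m + K ≤ n₀ + Rm := by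
  by_cases h : n₀ + Rm ≤ Kf
  · have := hKmin _ (hstopAt h)
    omega
  · omega

/-- **«THE FIRST INDUCTION STEP» INHABITED IN THE INDEX MODEL.**  Along a flow of [III] §2 on `[0, K_f]` — couplings in
`]0, γ]`, `γ ≤ 1` (`hI`, `hγ1`), sizes `R_n` from (2.5) (`hR`) carried by the cost constants (`hbR`), (2.9a) (`h29a`), (2.7)
(`h27`), the located smallness (`hΘ`), `L ≥ 4`, `O(1), M ≥ 0` — a non-empty face-connected region `Z ⊆ ℤᵈ` of
`MR_m`-cube indices BORN AT SCALE `m`, with a horizon `K` inside the flow (`hmK`) not exceeding any stopping index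
(`hKmin`; conditions (i), (ii) with `N = R_m`, `Nsz ≥ 64`, cleanliness `Clean` after the creation scale `hclean`), and a
bracket coefficient `a` satisfying print՚s located condition with the cell՚s constant (`hcond`), IS a `Birth b m`: coefficient
`a`, size `d′_m(Z) = treeLen Z`, horizon `K`, size profile `n ↦ d′_n(S^{n−m}(Z))` along the canonical flow, currency
`Q = 10·126^d·O(1)M^{d_b}L^{d_b+1}R_m^{d_b+2}` — its `hrhs` is (1.81) over the actual range (`card_majorant_181_and_stop_of_B14` ∘
`sum_le_third_181`, `hstop` by `hstop_of_min`), its `hcost` is `cost_le_third_181`. [cite: Balaban1989LargeFieldII, (1.81)–(1.82) p.385] -/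
theorem exists_birth_ofIndex (b : Budget.Consts) {L p Kf : ℕ} (hL : 4 ≤ L) {g : ℕ → ℝ} {γ β' β₀ : ℝ}
    (hI : Step.InInterval γ Kf g) (hγ1 : γ ≤ 1) (R : ℕ → ℕ)
    (hR : ∀ n, n ≤ Kf → B14.IsRj L p (g n) (R n)) (hbR : ∀ n, n ≤ Kf → b.R n = (R n : ℝ))
    (h29a : ∀ m n, m < n → n ≤ Kf → (R n : ℝ) ≤ L * R m) (h27 : B14.FlowIneq27 g β' β₀ p Kf)
    (hΘ : ∀ m n, m < n → n ≤ Kf → (1 + (g n) ^ 2 * β' * ((n : ℝ) - m)) ^ β₀ ≤ (L : ℝ) ^ (max (n - m) 2 / 2))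
    (hC : 0 ≤ b.C) (hM : 0 ≤ b.M) {Z : Finset (Pt d)} (hZ : Z.Nonempty) (hZc : FaceConnected Z)
    (m K : ℕ) (hmK : m + K ≤ Kf) (Nsz : ℕ) (hNsz : 64 ≤ Nsz) (Clean : ℕ → Prop)
    (hclean : ∀ l, 1 ≤ l → l ≤ Kf - m → Clean l)
    (hKmin : ∀ K', StopAt Nsz (R m) Clean (fun i => Siter (ratio L (fun i => Nat.log L (R (m + i)))) i Z) K' → K ≤ K')
    (a : ℝ) (hcond : 2 * (10 * 126 ^ d * (b.C * b.M ^ b.d * (L : ℝ) ^ (b.d + 1) * b.R m ^ (b.d + 2))) ≤ a) :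
    ∃ x : Birth b m, x.a = a ∧ x.d' = treeLen Z ∧ x.K = K ∧
      x.Q = 10 * 126 ^ d * (b.C * b.M ^ b.d * (L : ℝ) ^ (b.d + 1) * b.R m ^ (b.d + 2)) ∧
      x.size = fun n => treeLen (Siter (ratio L (fun i => Nat.log L (R (m + i)))) (n - m) Z) := by
  have hm : m ≤ Kf := by omega
  obtain ⟨n₀, hσ, hmn₀, hn₀K, -, -, hmid, -, hstopAt⟩ :=
    card_majorant_181_and_stop_of_B14 b hL hI hγ1 R hR hbR h29a h27 hΘ hC hM Z hZ hZc m hm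
  have hRm : b.R m = ((R m : ℕ) : ℝ) := hbR m hm
  have h1Rm : 1 ≤ R m := by
    rw [(hσ m hm)]
    exact Nat.one_le_pow _ _ (by omega)
  have hL1 : (1 : ℝ) ≤ (L : ℝ) := by exact_mod_cast (show 1 ≤ L by omega)
  have hp : (0 : ℝ) < 126 ^ d := by positivity
  have hA'1 : (1 : ℝ) ≤ 10 * 126 ^ d := by
    have : (1 : ℝ) ≤ 126 ^ d := one_le_pow₀ (by norm_num)
    linarith
  have hBA : (5 : ℝ) * 126 ^ d ≤ 10 * 126 ^ d := by linarith
  have hR0 : ∀ n, n ≤ Kf → 0 ≤ b.R n := by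
    intro n hn
    rw [hbR n hn]
    exact Nat.cast_nonneg _
  have hstop : m + K ≤ n₀ + R m :=
    hstop_of_min hmn₀ hmK (fun h => hstopAt Nsz (R m) Clean hNsz h1Rm hclean h) hKmin
  have hrhs := Step.Budget.sum_le_third_181 b (L : ℝ) (10 * 126 ^ d) (5 * 126 ^ d) (10 * 126 ^ d) (treeLen Z) Kf m
    n₀ K (R m) (fun n => treeLen (Siter (ratio L (fun i => Nat.log L (R (m + i)))) (n - m) Z)) hC hM
    (by positivity) (by positivity) le_rfl hBA (treeLen_nonneg Z) hn₀K hmK hRm h1Rm hstop hR0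
    (fun n => treeLen_nonneg _) hmid
  have hcost := Step.Budget.cost_le_third_181 b (L : ℝ) (10 * 126 ^ d) (treeLen Z) m (R m) hC hM hL1 hA'1
    (treeLen_nonneg Z) hRm h1Rm
  exact ⟨⟨a, treeLen Z, treeLen_nonneg Z, fun n => treeLen (Siter (ratio L (fun i => Nat.log L (R (m + i)))) (n - m) Z),
    K, 10 * 126 ^ d * (b.C * b.M ^ b.d * (L : ℝ) ^ (b.d + 1) * b.R m ^ (b.d + 2)), hrhs, hcost, hcond⟩,
    rfl, rfl, rfl, rfl, rfl⟩

/-- **(1.80) AT THE CREATION SCALE IN THE INDEX MODEL, END TO END** («Thus, by the estimate (1.81), the statement holds for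
j = 1 … if [the located condition]»): under the hypotheses of `exists_birth_ofIndex`, the (1.82)-budget
`a·(d′_m(Z) + 1) − O(1)M^dR_m^{d+1}d′_m(Z)` CONTROLS the `K` steps of `Z` — `Step.Budget.Controls` for the tree-length profile of
the `S`-iterates along the canonical flow; `Birth.controls` (`base_182`) of the inhabited birth data.  Inputs from outside the
tree՚s kernel: the flow displays of [III] §2, the located smallness of `B16SProfile`, print՚s located condition `hcond`, and the
reading of `K`. [cite: Balaban1989LargeFieldII, (1.80)–(1.82) pp.384–385] -/
theorem controls_ofIndex (b : Budget.Consts) {L p Kf : ℕ} (hL : 4 ≤ L) {g : ℕ → ℝ} {γ β' β₀ : ℝ}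
    (hI : Step.InInterval γ Kf g) (hγ1 : γ ≤ 1) (R : ℕ → ℕ)
    (hR : ∀ n, n ≤ Kf → B14.IsRj L p (g n) (R n)) (hbR : ∀ n, n ≤ Kf → b.R n = (R n : ℝ))
    (h29a : ∀ m n, m < n → n ≤ Kf → (R n : ℝ) ≤ L * R m) (h27 : B14.FlowIneq27 g β' β₀ p Kf)
    (hΘ : ∀ m n, m < n → n ≤ Kf → (1 + (g n) ^ 2 * β' * ((n : ℝ) - m)) ^ β₀ ≤ (L : ℝ) ^ (max (n - m) 2 / 2))
    (hC : 0 ≤ b.C) (hM : 0 ≤ b.M) {Z : Finset (Pt d)} (hZ : Z.Nonempty) (hZc : FaceConnected Z)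
    (m K : ℕ) (hmK : m + K ≤ Kf) (Nsz : ℕ) (hNsz : 64 ≤ Nsz) (Clean : ℕ → Prop)
    (hclean : ∀ l, 1 ≤ l → l ≤ Kf - m → Clean l)
    (hKmin : ∀ K', StopAt Nsz (R m) Clean (fun i => Siter (ratio L (fun i => Nat.log L (R (m + i)))) i Z) K' → K ≤ K')
    (a : ℝ) (hcond : 2 * (10 * 126 ^ d * (b.C * b.M ^ b.d * (L : ℝ) ^ (b.d + 1) * b.R m ^ (b.d + 2))) ≤ a) :
    Controls b m K (a * (treeLen Z + 1) - b.cost m (treeLen Z))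
      (fun n => treeLen (Siter (ratio L (fun i => Nat.log L (R (m + i)))) (n - m) Z)) := by
  obtain ⟨x, ha, hd, hK, -, hs⟩ := exists_birth_ofIndex b hL hI hγ1 R hR hbR h29a h27 hΘ hC hM hZ hZc m K hmK Nsz
    hNsz Clean hclean hKmin a hcond
  have h := x.controls
  rw [hK, hs] at h
  unfold Birth.κ' at h
  rw [ha, hd] at h
  exact h

/-- A NEW PIECE OF A MERGER from the index model (p. 386 «or by the first induction step», invoked at scale `j+1` for a new
large field region `Z_{j+1}^{(i)}`): the birth data of `exists_birth_ofIndex` at `m = j+1` as `Piece.new`, whose own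
(1.80)-sum is at most its bracket minus its creation cost (`Piece.rhs180_le`) — with bracket `a·(d′_{j+1}(Y) + 1)`, size
`d′_{j+1}(Y)`, horizon `K` and the tree-length profile of the iterates, all by name. [cite: Balaban1989LargeFieldII, (1.85) p.386] -/
theorem rhs180_le_new_ofIndex (b : Budget.Consts) {j : ℕ} (D : ScaleData j) {L p Kf : ℕ} (hL : 4 ≤ L) {g : ℕ → ℝ}
    {γ β' β₀ : ℝ} (hI : Step.InInterval γ Kf g) (hγ1 : γ ≤ 1) (R : ℕ → ℕ)
    (hR : ∀ n, n ≤ Kf → B14.IsRj L p (g n) (R n)) (hbR : ∀ n, n ≤ Kf → b.R n = (R n : ℝ))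
    (h29a : ∀ m n, m < n → n ≤ Kf → (R n : ℝ) ≤ L * R m) (h27 : B14.FlowIneq27 g β' β₀ p Kf)
    (hΘ : ∀ m n, m < n → n ≤ Kf → (1 + (g n) ^ 2 * β' * ((n : ℝ) - m)) ^ β₀ ≤ (L : ℝ) ^ (max (n - m) 2 / 2))
    (hC : 0 ≤ b.C) (hM : 0 ≤ b.M) {Y : Finset (Pt d)} (hY : Y.Nonempty) (hYc : FaceConnected Y)
    (K : ℕ) (hmK : j + 1 + K ≤ Kf) (Nsz : ℕ) (hNsz : 64 ≤ Nsz) (Clean : ℕ → Prop)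
    (hclean : ∀ l, 1 ≤ l → l ≤ Kf - (j + 1) → Clean l)
    (hKmin : ∀ K', StopAt Nsz (R (j + 1)) Clean
      (fun i => Siter (ratio L (fun i => Nat.log L (R (j + 1 + i)))) i Y) K' → K ≤ K')
    (a : ℝ) (hcond : 2 * (10 * 126 ^ d * (b.C * b.M ^ b.d * (L : ℝ) ^ (b.d + 1) * b.R (j + 1) ^ (b.d + 2))) ≤ a) :
    ∃ x : Birth b (j + 1), (Piece.new x : Piece b D).base = a * (treeLen Y + 1) ∧
      (Piece.new x : Piece b D).d1 = treeLen Y ∧ (Piece.new x : Piece b D).K = K ∧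
      (Piece.new x : Piece b D).size = (fun n => treeLen (Siter (ratio L (fun i => Nat.log L (R (j + 1 + i)))) (n - (j + 1)) Y)) ∧
      (Piece.new x : Piece b D).rhs180 b ≤ a * (treeLen Y + 1) - b.cost (j + 1) (treeLen Y) := by
  obtain ⟨x, ha, hd, hK, -, hs⟩ := exists_birth_ofIndex b hL hI hγ1 R hR hbR h29a h27 hΘ hC hM hY hYc (j + 1) K hmK
    Nsz hNsz Clean hclean hKmin a hcond
  refine ⟨x, ?_, ?_, ?_, ?_, ?_⟩
  · show x.a * (x.d' + 1) = _
    rw [ha, hd]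
  · show x.d' = _
    exact hd
  · show x.K = _
    exact hK
  · show x.size = _
    exact hs
  · have h := x.controls
    unfold Controls Birth.κ' at h
    show ∑ n ∈ Finset.Ioc (j + 1) (j + 1 + x.K), b.cost n (x.size n) ≤ _
    rw [ha, hd] at h
    exact h

/-- **THE BASE DATA OF THE OUTER INDUCTION FROM THE INDEX MODEL** (p. 385, `m = 1`: «Take a component Z of the region Z₁» —
every component a first induction step): scale-`m` bookkeeping data whose components carry non-empty face-connected index
regions `reg Z` born at `m` along one flow of [III] §2, whose size profiles ARE the tree-length profiles of the iterates
(`hsize`), whose horizons lie inside the flow and do not exceed a stopping index (`hKf`, `hKmin`; cleanliness per component),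
and whose budgets dominate the (1.82)-budget (`h182`: (1.82) «κ₁(Z) ≧ ¼γ₀(14)^{−d}A₁²p₀²(g₁)(d′₁(Z)+1) − O(1)M^dR₁^{d+1}d′₁(Z)» —
r13 g11՚s `B16Ineq182Gluing.ineq182_of_def` derives it from the (1.79)-shaped definition), with ONE coefficient `a` under print՚s
located condition: the inductive statement (1.80) holds at scale `m` for every component — `ScaleData.Invariant`, the `Base`
of `invariant_all`/`invariant_all_from` inhabited. [cite: Balaban1989LargeFieldII, (1.82) p.385] -/
theorem invariant_base_ofIndex (b : Budget.Consts) {m : ℕ} (D : ScaleData m) {L p Kf : ℕ} (hL : 4 ≤ L) {g : ℕ → ℝ}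
    {γ β' β₀ : ℝ} (hI : Step.InInterval γ Kf g) (hγ1 : γ ≤ 1) (R : ℕ → ℕ)
    (hR : ∀ n, n ≤ Kf → B14.IsRj L p (g n) (R n)) (hbR : ∀ n, n ≤ Kf → b.R n = (R n : ℝ))
    (h29a : ∀ m n, m < n → n ≤ Kf → (R n : ℝ) ≤ L * R m) (h27 : B14.FlowIneq27 g β' β₀ p Kf)
    (hΘ : ∀ m n, m < n → n ≤ Kf → (1 + (g n) ^ 2 * β' * ((n : ℝ) - m)) ^ β₀ ≤ (L : ℝ) ^ (max (n - m) 2 / 2))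
    (hC : 0 ≤ b.C) (hM : 0 ≤ b.M) (reg : D.Comp → Finset (Pt d)) (hne : ∀ Z, (reg Z).Nonempty)
    (hfc : ∀ Z, FaceConnected (reg Z)) (hKf : ∀ Z, m + D.K Z ≤ Kf) (Nsz : ℕ) (hNsz : 64 ≤ Nsz)
    (Clean : D.Comp → ℕ → Prop) (hclean : ∀ Z l, 1 ≤ l → l ≤ Kf - m → Clean Z l)
    (hKmin : ∀ Z K', StopAt Nsz (R m) (Clean Z)
      (fun i => Siter (ratio L (fun i => Nat.log L (R (m + i)))) i (reg Z)) K' → D.K Z ≤ K')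
    (hsize : ∀ Z, D.size Z = fun n => treeLen (Siter (ratio L (fun i => Nat.log L (R (m + i)))) (n - m) (reg Z)))
    (a : ℝ) (hcond : 2 * (10 * 126 ^ d * (b.C * b.M ^ b.d * (L : ℝ) ^ (b.d + 1) * b.R m ^ (b.d + 2))) ≤ a)
    (h182 : ∀ Z, a * (treeLen (reg Z) + 1) - b.cost m (treeLen (reg Z)) ≤ D.κ Z) :
    D.Invariant b := by
  intro Z
  rw [hsize Z]
  exact controls_mono_κ b m _ _ (controls_ofIndex b hL hI hγ1 R hR hbR h29a h27 hΘ hC hM (hne Z) (hfc Z) m (D.K Z)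
    (hKf Z) Nsz hNsz (Clean Z) (hclean Z) (hKmin Z) a hcond) (h182 Z)

/-! ## §9 (v1.3). The outer induction from an invariant at the first scale; the index-model capstone (1.80) ⇒ (1.89)

APPEND-ONLY addition (r13 gen 19, v1.3; + the docfix of the §8 quotation order): `invariant_all`/`invariant_all_from` (§4) take the base
as `Base` DATA (a `Birth` per component); §8 delivers the base as the PROPOSITION `(D j₀).Invariant b` (`invariant_base_ofIndex`).  The
same induction from the proposition, and the composition with §5 and §8: from base data read from index regions at a first scale `j₀`
and a printed-case transition at every later scale, (1.80) holds at every scale `j ≥ j₀` and (1.89) for every horizon-`0` component —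
p. 387 «This completes the inductive proof of the statement. Let us draw some conclusions from the statement. At first, the domain X in
the definition (1.71) satisfies the assumption of the statement with K = 0, therefore κ_k(X) ≧ 0, and we have the fundamental
inequality 𝐓′_k(X)1 ≦ exp(−2(1+β₀)^{−1}p₀(g_k)). (1.89)». -/

/-- THE OUTER INDUCTION FROM THE INVARIANT AT A FIRST SCALE `j₀` (§4՚s `invariant_all_from` with the base given as the proposition
`(D j₀).Invariant b` rather than as `Base` data): (1.80) at `j₀` and a printed-case transition at every `j ≥ j₀` give (1.80) at every
`j ≥ j₀`. [cite: Balaban1989LargeFieldII, (1.80) p.384, proof pp.384–387] -/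
theorem invariant_all_of_invariant (b : Budget.Consts) (D : (j : ℕ) → ScaleData j) (j₀ : ℕ) (hB : (D j₀).Invariant b)
    (T : ∀ j, j₀ ≤ j → Transition b (D j) (D (j + 1))) : ∀ j, j₀ ≤ j → (D j).Invariant b := by
  intro j hj
  induction j with
  | zero =>
    have : j₀ = 0 := by omega
    subst this
    exact hB
  | succ j ih =>
    by_cases h0 : j₀ = j + 1
    · subst h0
      exact hB
    · exact invariant_succ b (ih (by omega)) (T j (by omega))

/-- (1.89) at every scale `k ≥ j₀` for every horizon-`0` component, from the invariant at `j₀` and the transitions — §5 ∘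
`invariant_all_of_invariant`. [cite: Balaban1989LargeFieldII, (1.89) p.387] -/
theorem fundIneq189_from_invariant (b : Budget.Consts) (D : (j : ℕ) → ScaleData j) (j₀ : ℕ) (hB : (D j₀).Invariant b)
    (T : ∀ j, j₀ ≤ j → Transition b (D j) (D (j + 1))) {k : ℕ} (hk : j₀ ≤ k) (X : (D k).Comp) (hK : (D k).K X = 0)
    {V : Type*} (T1X : V → ℝ) (A₀ : ℝ) (p₀ : ℕ) (β₀ gk Pj : ℝ)
    (hT : ∀ v, T1X v ≤ Real.exp (-(D k).κ X - Pj)) (hP : 2 * (1 + β₀)⁻¹ * p0Profile A₀ p₀ gk ≤ Pj) :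
    FundIneq189 T1X A₀ p₀ β₀ gk :=
  fundIneq189_of_invariant b (invariant_all_of_invariant b D j₀ hB T k hk) X hK T1X A₀ p₀ β₀ gk Pj hT hP

/-- **THE INDEX-MODEL CAPSTONE OF THE ROW, (1.80) HALF**: bookkeeping data `D j` at every scale whose FIRST-SCALE components
(`j₀`; print: `j₀ = 1`, «Take a component Z of the region Z₁») carry non-empty face-connected index regions born at `j₀` along a flow of
[III] §2 with the tree-length profiles of their `S`-iterates, horizons inside the flow not exceeding a stopping index, budgets
dominating the (1.82)-budget, ONE bracket coefficient under print՚s located condition (the hypotheses of `invariant_base_ofIndex`), and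
a printed-case `Transition` at every scale `j ≥ j₀` (§4: continuation (1.83) ∣ reset p. 386 ∣ lone new region ∣ merger (1.85)–(1.88),
e.g. §7՚s `MergeIndex.toCase` with new pieces from `rhs180_le_new_ofIndex`): THEN (1.80) holds for every component at every scale
`j ≥ j₀`.  `invariant_base_ofIndex` ∘ `invariant_all_of_invariant`. [cite: Balaban1989LargeFieldII, (1.80) p.384, (1.82) p.385] -/
theorem invariant_all_ofIndex (b : Budget.Consts) (D : (j : ℕ) → ScaleData j) (j₀ : ℕ) {L p Kf : ℕ} (hL : 4 ≤ L) {g : ℕ → ℝ}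
    {γ β' β₀f : ℝ} (hI : Step.InInterval γ Kf g) (hγ1 : γ ≤ 1) (R : ℕ → ℕ)
    (hR : ∀ n, n ≤ Kf → B14.IsRj L p (g n) (R n)) (hbR : ∀ n, n ≤ Kf → b.R n = (R n : ℝ))
    (h29a : ∀ m n, m < n → n ≤ Kf → (R n : ℝ) ≤ L * R m) (h27 : B14.FlowIneq27 g β' β₀f p Kf)
    (hΘ : ∀ m n, m < n → n ≤ Kf → (1 + (g n) ^ 2 * β' * ((n : ℝ) - m)) ^ β₀f ≤ (L : ℝ) ^ (max (n - m) 2 / 2))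
    (hC : 0 ≤ b.C) (hM : 0 ≤ b.M) (reg : (D j₀).Comp → Finset (Pt d)) (hne : ∀ Z, (reg Z).Nonempty)
    (hfc : ∀ Z, FaceConnected (reg Z)) (hKf : ∀ Z, j₀ + (D j₀).K Z ≤ Kf) (Nsz : ℕ) (hNsz : 64 ≤ Nsz)
    (Clean : (D j₀).Comp → ℕ → Prop) (hclean : ∀ Z l, 1 ≤ l → l ≤ Kf - j₀ → Clean Z l)
    (hKmin : ∀ Z K', StopAt Nsz (R j₀) (Clean Z)
      (fun i => Siter (ratio L (fun i => Nat.log L (R (j₀ + i)))) i (reg Z)) K' → (D j₀).K Z ≤ K')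
    (hsize : ∀ Z, (D j₀).size Z = fun n => treeLen (Siter (ratio L (fun i => Nat.log L (R (j₀ + i)))) (n - j₀) (reg Z)))
    (a : ℝ) (hcond : 2 * (10 * 126 ^ d * (b.C * b.M ^ b.d * (L : ℝ) ^ (b.d + 1) * b.R j₀ ^ (b.d + 2))) ≤ a)
    (h182 : ∀ Z, a * (treeLen (reg Z) + 1) - b.cost j₀ (treeLen (reg Z)) ≤ (D j₀).κ Z)
    (T : ∀ j, j₀ ≤ j → Transition b (D j) (D (j + 1))) : ∀ j, j₀ ≤ j → (D j).Invariant b :=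
  invariant_all_of_invariant b D j₀
    (invariant_base_ofIndex b (D j₀) hL hI hγ1 R hR hbR h29a h27 hΘ hC hM reg hne hfc hKf Nsz hNsz Clean hclean hKmin hsize
      a hcond h182) T

/-- **THE INDEX-MODEL CAPSTONE OF THE ROW, (1.89) HALF**: under the hypotheses of `invariant_all_ofIndex`, every horizon-`0` component `X`
at any scale `k ≥ j₀` whose factor has the p. 384 form `𝐓′1 ≤ exp(−κ_k(X) − P)` with the profile slack `P ≥ 2(1+β₀)⁻¹p₀(g_k)`
satisfies the fundamental inequality (1.89) `Step.FundIneq189` — «At first, the domain X in the definition (1.71) satisfies the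
assumption of the statement with K = 0, therefore κ_k(X) ≧ 0, and we have the fundamental inequality 𝐓′_k(X)1 ≦ exp(−2(1+β₀)^{−1}
p₀(g_k)). (1.89)».  `invariant_all_ofIndex` ∘ `fundIneq189_of_invariant`. [cite: Balaban1989LargeFieldII, (1.89) p.387] -/
theorem fundIneq189_ofIndex (b : Budget.Consts) (D : (j : ℕ) → ScaleData j) (j₀ : ℕ) {L p Kf : ℕ} (hL : 4 ≤ L) {g : ℕ → ℝ}
    {γ β' β₀f : ℝ} (hI : Step.InInterval γ Kf g) (hγ1 : γ ≤ 1) (R : ℕ → ℕ)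
    (hR : ∀ n, n ≤ Kf → B14.IsRj L p (g n) (R n)) (hbR : ∀ n, n ≤ Kf → b.R n = (R n : ℝ))
    (h29a : ∀ m n, m < n → n ≤ Kf → (R n : ℝ) ≤ L * R m) (h27 : B14.FlowIneq27 g β' β₀f p Kf)
    (hΘ : ∀ m n, m < n → n ≤ Kf → (1 + (g n) ^ 2 * β' * ((n : ℝ) - m)) ^ β₀f ≤ (L : ℝ) ^ (max (n - m) 2 / 2))
    (hC : 0 ≤ b.C) (hM : 0 ≤ b.M) (reg : (D j₀).Comp → Finset (Pt d)) (hne : ∀ Z, (reg Z).Nonempty)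
    (hfc : ∀ Z, FaceConnected (reg Z)) (hKf : ∀ Z, j₀ + (D j₀).K Z ≤ Kf) (Nsz : ℕ) (hNsz : 64 ≤ Nsz)
    (Clean : (D j₀).Comp → ℕ → Prop) (hclean : ∀ Z l, 1 ≤ l → l ≤ Kf - j₀ → Clean Z l)
    (hKmin : ∀ Z K', StopAt Nsz (R j₀) (Clean Z)
      (fun i => Siter (ratio L (fun i => Nat.log L (R (j₀ + i)))) i (reg Z)) K' → (D j₀).K Z ≤ K')
    (hsize : ∀ Z, (D j₀).size Z = fun n => treeLen (Siter (ratio L (fun i => Nat.log L (R (j₀ + i)))) (n - j₀) (reg Z)))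
    (a : ℝ) (hcond : 2 * (10 * 126 ^ d * (b.C * b.M ^ b.d * (L : ℝ) ^ (b.d + 1) * b.R j₀ ^ (b.d + 2))) ≤ a)
    (h182 : ∀ Z, a * (treeLen (reg Z) + 1) - b.cost j₀ (treeLen (reg Z)) ≤ (D j₀).κ Z)
    (T : ∀ j, j₀ ≤ j → Transition b (D j) (D (j + 1))) {k : ℕ} (hk : j₀ ≤ k) (X : (D k).Comp) (hK : (D k).K X = 0)
    {V : Type*} (T1X : V → ℝ) (A₀ : ℝ) (p₀ : ℕ) (β₀ gk Pj : ℝ)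
    (hT : ∀ v, T1X v ≤ Real.exp (-(D k).κ X - Pj)) (hP : 2 * (1 + β₀)⁻¹ * p0Profile A₀ p₀ gk ≤ Pj) :
    FundIneq189 T1X A₀ p₀ β₀ gk :=
  fundIneq189_of_invariant b
    (invariant_all_ofIndex b D j₀ hL hI hγ1 R hR hbR h29a h27 hΘ hC hM reg hne hfc hKf Nsz hNsz Clean hclean hKmin hsize a hcond
      h182 T k hk) X hK T1X A₀ p₀ β₀ gk Pj hT hP

/-! ## §10 (v1.4). THE RESET OF p. 386 IN THE INDEX MODEL: `ResetPiece` inhabited — «because Z is a small domain, it is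
contained in a cube of the size 100MR_{j+1}, hence K = R_{j+1} for Z»

APPEND-ONLY addition (r13 gen 20, v1.4): nothing above is changed, no `import` added.  THE PRINT (p. 385 [PDF 31] last three
lines – p. 386 [PDF 32] ll. 1–3, re-read on the x2 render `…-II-p032-x2.png`): «In this case we should consider also the domains Z
such that Z = S(Z₀), Z₀ satisfies the conditions (i), (ii), and a new large field was introduced in the preparatory operations.
Then κ_j(Z₀) ≧ 0, and we do not have a better bound for it, but we have the new factor exp(−p₀(g_j)). We define κ_{j+1}(Z) =
p₀(g_j) − O(1)M^dR_{j+1}^{d+1}d′_{j+1}(Z). It satisfies (1.80), because Z is a small domain, it is contained in a cube of the size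
100MR_{j+1}, hence K = R_{j+1} for Z.»  §2՚s `ResetPiece` carries the one binder of `Step.Budget.reset_p386`, `hsmall :
Σ_{n=j+1}^{j+1+K} cost_n(d′_n) ≤ p` («the fresh factor pays the small domain՚s costs»).  HERE IT IS DISCHARGED in the ℤᵈ index
model of `B16SProfile`/`B16StoppingRule` (the model of §§7–9), following the printed sentence: (a) «Z is a small domain»: if
`Z₀` lies in a box of index radius `r₀ ≥ 22` of `MR_j`-cubes (condition (i): print `100` per side, `r₀ = 50`), then along the
flow EVERY iterate `S^i(Z₀)` — in particular `Z = S(Z₀)` and all `S^l(Z)` — lies in a box of radius `r₀ + 10` of the current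
cubes (`Siter_subset_box_radInv`, the radius invariant of `B16SProfile.Siter_singleton_subset_box` started from a box instead of
one cube: radius `≤ r₀` except right after a no-gain step, never two of those in a row under the drop control of (2.7)/(2.9));
(b) «hence K = R_{j+1} for Z»: so (i) holds for `Z` and all its iterates with any size parameter `Nsz ≥ 2r₀ + 21`, the stopping
property (inclusive (ii), memory `N = R_{j+1}`) holds at `R_{j+1}` once the `R_{j+1}` post-reset steps are clean, and print՚s least
`K` is `≤ R_{j+1}` (`K_le_R_of_small`; `= R_{j+1}` for a stopping index, `K_eq_R_of_small`); (c) the implicit cost estimate: every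
size `d′_n(S^{n−j−1}(Z)) ≤ (2r₀+21)^d − 1` (`treeLen_le_of_subset_box`), `R_n ≤ LR_{j+1}` on the range by (2.9a), `K + 1 ≤ 2R_{j+1}`,
so `Σ_{n=j+1}^{j+1+K} cost_n ≤ 2(2r₀+21)^d·O(1)M^{d_b}L^{d_b+1}R_{j+1}^{d_b+2}` (`sum_cost_le_of_small`) and `hsmall` follows from the
LOCATED CONDITION `hcondR : 2(2r₀+21)^d·O(1)M^{d_b}L^{d_b+1}R_{j+1}^{d_b+2} ≤ p₀(g_j)` — of the kind print states for the neighbouring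
cases («This condition is satisfied for p₀ large, and g₁ sufficiently small» p. 385; «for p₀ large and γ small enough» p. 387) and
leaves implicit here; **`exists_reset_ofIndex`** (the `ResetPiece` of §2 with `hsmall` DISCHARGED), **`controls_reset_ofIndex`**
((1.80) at scale `j+1` for the reset component END TO END).  After §§7–10 every printed case of the `Transition` of §4 takes from
outside the tree՚s kernel only: the flow displays of [III] §2, located conditions (`hcond`, `hcondR`, `hbudget`), (1.82), (1.84),
(2.7a), print՚s `hsub`, and the readings of `K`.
HONEST SCOPE / LOCATED CONSTANT (kind: model reading, constants only; cf. cell `DIVERGENCE.md` D-b02g9.1).  Print has ONE size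
`100` in (i) before and after the reset.  In the index model a NO-GAIN creation step (`q_j = 1`: ten layers added at full size)
takes a box of `100` per side to one of `121` per side, so «it is contained in a cube of the size 100MR_{j+1}» holds as printed at a
gaining step (`q_j ≥ L ≥ 4`: radius `⌊50/q_j⌋ + 11 ≤ 23`, side `≤ 47`; `condI_Sop_of_subset_box`) and with `121` for `100` at a
no-gain step; the theorems therefore carry TWO parameters — the radius `r₀` of `Z₀`՚s box (print `100` per side) and the later size
parameter `Nsz ≥ 2r₀ + 21` (print: the same `100`; any `Nsz ≥ 64` is admissible for the stopping rule of `B16StoppingRule`).  As in §8,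
`Clean` (the large-field clause of (ii)) is a parameter predicate assumed after the creation scale (p. 384 «under the assumption that
no large fields are created in these steps»), `K` is any horizon inside the flow not exceeding a stopping index, and nothing
identifies the index model with print՚s domains. -/

open Literature.MathematicalPhysics.QuantumFieldTheory.Balaban1983to89.B13ScaleTransfer
open Literature.MathematicalPhysics.QuantumFieldTheory.Balaban1983to89.TreeLength

/-- «Z IS A SMALL DOMAIN» ALONG THE FLOW — the radius invariant of `B16SProfile.Siter_singleton_subset_box` started from a box: under
the drop control on `[0, m]` and `L ≥ 3`, if `Z ⊆ □_c^{~A}` (index box of radius `A ≥ 22`), then every iterate `S^i(Z)`, `i ≤ m`, lies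
in an index box of radius `r ≤ A + 10`, with `r ≤ A` unless the last step was a no-gain step (`σ_{i−1} = σ_i + 1`): a no-gain step
(`q = 1`) finds `r ≤ A` (two consecutive no-gain steps are excluded by `DropCtl.lag_two`) and adds ten layers; a gaining step
(`q ≥ L ≥ 3`) gives `⌊r/q⌋ + 11 ≤ ⌊(A+10)/3⌋ + 11 ≤ A`. [cite: Balaban1989LargeFieldII, §1 p.386 l.2-3 (Z is a small domain)] -/
theorem Siter_subset_box_radInv {L : ℕ} {σ : ℕ → ℕ} {m A : ℕ} (hL : 3 ≤ L) (h : DropCtl σ m) (hA : 22 ≤ A)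
    {Z : Finset (Pt d)} {c : Pt d} (hZ : Z ⊆ box c A) :
    ∀ i, i ≤ m → ∃ (c' : Pt d) (r : ℕ), r ≤ A + 10 ∧ (r ≤ A ∨ (1 ≤ i ∧ σ (i - 1) = σ i + 1)) ∧
      Siter (ratio L σ) i Z ⊆ box c' r
  | 0 => fun _ => ⟨c, A, by omega, Or.inl le_rfl, by simpa using hZ⟩
  | i + 1 => fun hi => by
      obtain ⟨c', r, hrA, hflag, hsub⟩ := Siter_subset_box_radInv hL h hA hZ i (by omega)
      have hdn : σ i ≤ σ (i + 1) + 1 := h.lag_one hi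
      have hL0 : 0 < L := by omega
      rw [Siter_succ]
      rcases Nat.eq_zero_or_pos (qexp σ i) with he | he
      · -- no-gain step: the partition does not change, ten layers are added at full size
        have hq1 : ratio L σ i = 1 := by simp [ratio, he]
        have hσ : σ i = σ (i + 1) + 1 := by unfold qexp at he; omega
        have hrA' : r ≤ A := by
          rcases hflag with h1 | ⟨hi1, hσ'⟩
          · exact h1
          · exfalso
            have h2 := h.lag_two (i := i - 1) (by omega)
            rw [show i - 1 + 2 = i + 1 by omega] at h2
            omega
        refine ⟨c', r + 10, by omega, Or.inr ⟨by omega, by simpa using hσ⟩, ?_⟩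
        rw [hq1]
        exact (Sop_mono 1 hsub).trans (Sop_one_box_subset c' r)
      · -- gaining step: `ratio = L^e ≥ L ≥ 3`, the radius contracts below `A`
        have hq : L ≤ ratio L σ i := by
          unfold ratio
          exact Nat.le_self_pow (by omega) L
        have h1 : r / ratio L σ i ≤ r / L := Nat.div_le_div_left hq hL0
        have h2 : r / L ≤ r / 3 := Nat.div_le_div_left hL (by norm_num)
        exact ⟨coarse (ratio L σ i) c', r / ratio L σ i + 11, by omega, Or.inl (by omega),
          (Sop_mono _ hsub).trans (Sop_box_subset (ratio_pos hL0 σ i) c' r)⟩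

/-- Every iterate of a domain in an index box of radius `A ≥ 22` lies in an index box of radius `A + 10` (drop control, `L ≥ 3`).
[cite: Balaban1989LargeFieldII, §1 p.386 l.2-3 (Z is a small domain)] -/
theorem Siter_subset_box_of_subset_box {L : ℕ} {σ : ℕ → ℕ} {m A : ℕ} (hL : 3 ≤ L) (h : DropCtl σ m) (hA : 22 ≤ A)
    {Z : Finset (Pt d)} {c : Pt d} (hZ : Z ⊆ box c A) {i : ℕ} (hi : i ≤ m) :
    ∃ c' : Pt d, Siter (ratio L σ) i Z ⊆ box c' (A + 10) := by
  obtain ⟨c', r, hr, -, hsub⟩ := Siter_subset_box_radInv hL h hA hZ i hi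
  exact ⟨c', hsub.trans (box_mono c' hr)⟩

/-- A domain in an index box of radius `r` satisfies condition (i) with `2r + 1` cubes per side (`B16StoppingRule.CondI` =
`B14BoxFix.FitsIn`). [cite: Balaban1989LargeFieldI, p.177 (condition (i))] -/
theorem condI_of_subset_box {X : Finset (Pt d)} {c : Pt d} {r : ℕ} (h : X ⊆ box c r) : CondI (2 * r + 1) X := by
  refine ⟨fun i => c i - r, ?_⟩
  intro y hy
  have hy' := mem_box.mp (h (Finset.mem_coe.mp hy))
  intro i
  obtain ⟨h1, h2⟩ := hy' i
  push_cast
  constructor <;> omega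

/-- Conversely, condition (i) with `N` cubes per side puts the domain in an index box of radius `⌊N/2⌋` (print՚s «contained in a
cube of the size 100 MR_k» ↦ radius `50`). [cite: Balaban1989LargeFieldI, p.177 (condition (i))] -/
theorem subset_box_of_condI {N : ℕ} {X : Finset (Pt d)} (h : CondI N X) : ∃ c : Pt d, X ⊆ box c (N / 2) := by
  obtain ⟨lo, hlo⟩ := h
  refine ⟨fun i => lo i + ((N / 2 : ℕ) : ℤ), fun y hy => ?_⟩
  have hy' := hlo (Finset.mem_coe.mpr hy)
  rw [mem_box]
  intro i
  obtain ⟨h1, h2⟩ := hy' i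
  simp only at h1 h2 ⊢
  constructor <;> omega

/-- ONE STEP: `S` takes a domain in a box of radius `r₀` into a box of radius `⌊r₀/q⌋ + 11`, hence into (i) with
`2(⌊r₀/q⌋ + 11) + 1` per side — print՚s «it is contained in a cube of the size 100MR_{j+1}» AS PRINTED at a gaining step
(`r₀ = 50`, `q ≥ 4`: `47 ≤ 100` per side), with `123` at a no-gain step `q = 1` (the sharper `2r₀ + 21` follows from
`Siter_subset_box_radInv`). [cite: Balaban1989LargeFieldII, §1 p.386 l.2-3 (contained in a cube of the size 100MR_{j+1})] -/
theorem condI_Sop_of_subset_box {q : ℕ} (hq : 0 < q) {Z₀ : Finset (Pt d)} {c : Pt d} {r₀ : ℕ} (h : Z₀ ⊆ box c r₀) :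
    CondI (2 * (r₀ / q + 11) + 1) (Sop q Z₀) :=
  condI_of_subset_box ((Sop_mono q h).trans (Sop_box_subset hq c r₀))

/-- The linear size of a (non-empty, face-connected) domain in an index box of radius `r` is at most `(2r+1)^d − 1`
(`TreeLength.treeLen_le_card_sub_one`, `B16SProfile.card_box`). [cite: Balaban1989LargeFieldII, §1 p.386 l.2-3 (Z is a small domain)] -/
theorem treeLen_le_of_subset_box {X : Finset (Pt d)} (hX : X.Nonempty) (hXc : FaceConnected X) {c : Pt d} {r : ℕ}
    (h : X ⊆ box c r) : treeLen X ≤ (2 * r + 1 : ℝ) ^ d - 1 := by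
  have h1 := treeLen_le_card_sub_one hX hXc
  have h2 : (X.card : ℝ) ≤ (2 * r + 1 : ℝ) ^ d := by
    have := Finset.card_le_card h
    rw [card_box] at this
    exact_mod_cast this
  linarith

/-- `S^{i+1}(X) = S^{i}(S(X))` along the shifted ratio sequence — the iterates of `Z = S(Z₀)` are the later iterates of `Z₀`. [folklore]
[cite: Balaban1989LargeFieldII, p.384 (the operation S may be iterated)] -/
theorem Siter_succ_eq_Siter_Sop (q : ℕ → ℕ) (i : ℕ) (X : Finset (Pt d)) :
    Siter q (i + 1) X = Siter (fun l => q (l + 1)) i (Sop (q 0) X) := by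
  induction i with
  | zero => rfl
  | succ i ih => rw [Siter_succ, ih, Siter_succ]

/-- The flow՚s ratio sequence read from scale `j + 1` is the shift of the one read from scale `j` (sizes `R_n = L^{σ_n}`,
`σ_n = log_L R_n`). [cite: Balaban1988Convergent, (2.5) p.255] -/
theorem ratio_shift_log (L : ℕ) (R : ℕ → ℕ) (j : ℕ) :
    (fun l => ratio L (fun i => Nat.log L (R (j + i))) (l + 1)) = ratio L (fun i => Nat.log L (R (j + 1 + i))) := by
  funext l
  show L ^ (Nat.log L (R (j + (l + 1 + 1))) + 1 - Nat.log L (R (j + (l + 1)))) =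
    L ^ (Nat.log L (R (j + 1 + (l + 1))) + 1 - Nat.log L (R (j + 1 + l)))
  rw [show j + (l + 1 + 1) = j + 1 + (l + 1) by omega, show j + (l + 1) = j + 1 + l by omega]

/-- `S^{l+1}(Z₀)` (iterating from scale `j`) `= S^{l}(S(Z₀))` (iterating from scale `j+1`): the size profile of the reset component
`Z = S(Z₀)` is the tail of `Z₀`՚s. [cite: Balaban1989LargeFieldII, §1 p.386 l.1-3 (Z = S(Z₀))] -/
theorem Siter_shift_log (L : ℕ) (R : ℕ → ℕ) (j l : ℕ) (X : Finset (Pt d)) :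
    Siter (ratio L (fun i => Nat.log L (R (j + i)))) (l + 1) X =
      Siter (ratio L (fun i => Nat.log L (R (j + 1 + i)))) l
        (Sop (ratio L (fun i => Nat.log L (R (j + i))) 0) X) := by
  rw [Siter_succ_eq_Siter_Sop, ratio_shift_log]

/-- THE COST OF A SMALL DOMAIN OVER `R_{j+1}` STEPS (the estimate print leaves implicit in «It satisfies (1.80), because Z is a small
domain»): if the sizes on the range `j < n ≤ j + 1 + K` are `≤ S`, `K ≤ R_{j+1}`, `R_{j+1} ≥ 1` and `R_n ≤ LR_{j+1}` there ((2.9a), first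
member of [III] (2.9)), then `Σ_{n=j+1}^{j+1+K} O(1)M^{d_b}R_n^{d_b+1}s_n ≤ 2S·O(1)M^{d_b}L^{d_b+1}R_{j+1}^{d_b+2}` (`K + 1 ≤ 2R_{j+1}` terms, each
`≤ O(1)M^{d_b}(LR_{j+1})^{d_b+1}S`). [cite: Balaban1989LargeFieldII, §1 p.386 l.2-3 (It satisfies (1.80))] -/
theorem sum_cost_le_of_small (b : Budget.Consts) {L Kf j K : ℕ} (hL1 : 1 ≤ L) (R : ℕ → ℕ)
    (hbR : ∀ n, n ≤ Kf → b.R n = (R n : ℝ)) (h29a : ∀ m n, m < n → n ≤ Kf → (R n : ℝ) ≤ L * R m)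
    (hC : 0 ≤ b.C) (hM : 0 ≤ b.M) (hmK : j + 1 + K ≤ Kf) (h1R : 1 ≤ R (j + 1)) (hKR : K ≤ R (j + 1))
    (S : ℝ) (hS : 0 ≤ S) (s : ℕ → ℝ) (hs0 : ∀ n, 0 ≤ s n) (hs : ∀ n ∈ Finset.Ioc j (j + 1 + K), s n ≤ S) :
    ∑ n ∈ Finset.Ioc j (j + 1 + K), b.cost n (s n) ≤
      2 * S * (b.C * b.M ^ b.d * (L : ℝ) ^ (b.d + 1) * b.R (j + 1) ^ (b.d + 2)) := by
  have hRj : b.R (j + 1) = (R (j + 1) : ℝ) := hbR (j + 1) (by omega)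
  have hR1 : (1 : ℝ) ≤ b.R (j + 1) := by rw [hRj]; exact_mod_cast h1R
  have hR0 : (0 : ℝ) ≤ b.R (j + 1) := by linarith
  have hL1' : (1 : ℝ) ≤ (L : ℝ) := by exact_mod_cast hL1
  have hCM : 0 ≤ b.C * b.M ^ b.d := by positivity
  set T : ℝ := b.C * b.M ^ b.d * ((L : ℝ) * b.R (j + 1)) ^ (b.d + 1) * S with hT
  have hT0 : 0 ≤ T := by positivity
  have hterm : ∀ n ∈ Finset.Ioc j (j + 1 + K), b.cost n (s n) ≤ T := by
    intro n hn
    have hn' := Finset.mem_Ioc.mp hn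
    have hnK : n ≤ Kf := by omega
    have hRn0 : 0 ≤ b.R n := by rw [hbR n hnK]; exact Nat.cast_nonneg _
    have hRn : b.R n ≤ (L : ℝ) * b.R (j + 1) := by
      rw [hbR n hnK, hRj]
      rcases Nat.lt_or_ge (j + 1) n with hlt | hge
      · exact h29a (j + 1) n hlt hnK
      · have hn1 : n = j + 1 := by omega
        rw [hn1]
        have h0 : (0 : ℝ) ≤ (R (j + 1) : ℝ) := Nat.cast_nonneg _
        nlinarith
    have hpow : b.R n ^ (b.d + 1) ≤ ((L : ℝ) * b.R (j + 1)) ^ (b.d + 1) := pow_le_pow_left₀ hRn0 hRn _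
    unfold Consts.cost
    calc b.C * b.M ^ b.d * b.R n ^ (b.d + 1) * s n
        ≤ b.C * b.M ^ b.d * ((L : ℝ) * b.R (j + 1)) ^ (b.d + 1) * s n :=
          mul_le_mul_of_nonneg_right (mul_le_mul_of_nonneg_left hpow hCM) (hs0 n)
      _ ≤ b.C * b.M ^ b.d * ((L : ℝ) * b.R (j + 1)) ^ (b.d + 1) * S :=
          mul_le_mul_of_nonneg_left (hs n hn) (by positivity)
  have hsum := Finset.sum_le_card_nsmul _ _ _ hterm
  rw [Nat.card_Ioc, nsmul_eq_mul] at hsum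
  have hcard : ((j + 1 + K - j : ℕ) : ℝ) ≤ 2 * b.R (j + 1) := by
    rw [show j + 1 + K - j = K + 1 by omega, hRj]
    have : (K : ℝ) ≤ R (j + 1) := by exact_mod_cast hKR
    have h1 : (1 : ℝ) ≤ R (j + 1) := by exact_mod_cast h1R
    push_cast
    linarith
  calc ∑ n ∈ Finset.Ioc j (j + 1 + K), b.cost n (s n) ≤ ((j + 1 + K - j : ℕ) : ℝ) * T := hsum
    _ ≤ 2 * b.R (j + 1) * T := mul_le_mul_of_nonneg_right hcard hT0
    _ = 2 * S * (b.C * b.M ^ b.d * (L : ℝ) ^ (b.d + 1) * b.R (j + 1) ^ (b.d + 2)) := by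
          rw [hT]; ring

/-- **«HENCE K = R_{j+1} FOR Z»** (the inequality print uses): for the reset component `Z = S(Z₀)` with `Z₀ ⊆ □_c^{~r₀}` (`r₀ ≥ 22`;
condition (i) at scale `j`), every iterate of `Z` satisfies (i) with any size parameter `Nsz ≥ 2r₀ + 21`
(`Siter_subset_box_of_subset_box` along the flow from scale `j`, `Siter_shift_log`), so — the `R_{j+1}` steps after the reset being
clean — the stopping property (inclusive (ii), memory `N = R_{j+1}`) HOLDS AT `R_{j+1}`, and a horizon `K` inside the flow
(`j + 1 + K ≤ K_f`) not exceeding any stopping index (`hKmin`; print՚s least `K`) is `≤ R_{j+1}` (if the flow ends before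
`j + 1 + R_{j+1}`, already `K < R_{j+1}`). [cite: Balaban1989LargeFieldII, §1 p.386 l.3 (hence K = R_{j+1} for Z)] -/
theorem K_le_R_of_small {L : ℕ} {R : ℕ → ℕ} {Kf j K Nsz r₀ : ℕ} (hL : 3 ≤ L)
    (hD : DropCtl (fun i => Nat.log L (R (j + i))) (Kf - j)) (hr₀ : 22 ≤ r₀)
    {Z₀ : Finset (Pt d)} {c : Pt d} (hZ₀ : Z₀ ⊆ box c r₀) (hmK : j + 1 + K ≤ Kf) (hNsz : 2 * r₀ + 21 ≤ Nsz)
    (h1R : 1 ≤ R (j + 1)) (Clean : ℕ → Prop) (hclean : ∀ l, 1 ≤ l → l ≤ Kf - (j + 1) → Clean l)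
    (hKmin : ∀ K', StopAt Nsz (R (j + 1)) Clean
      (fun i => Siter (ratio L (fun i => Nat.log L (R (j + 1 + i)))) i
        (Sop (ratio L (fun i => Nat.log L (R (j + i))) 0) Z₀)) K' → K ≤ K') :
    K ≤ R (j + 1) := by
  by_cases hroom : j + 1 + R (j + 1) ≤ Kf
  · apply hKmin
    have hI : ∀ l, l ≤ R (j + 1) → CondI Nsz (Siter (ratio L (fun i => Nat.log L (R (j + 1 + i)))) l
        (Sop (ratio L (fun i => Nat.log L (R (j + i))) 0) Z₀)) := by
      intro l hl
      rw [← Siter_shift_log L R j l Z₀]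
      obtain ⟨c', hsub⟩ := Siter_subset_box_of_subset_box hL hD hr₀ hZ₀ (i := l + 1) (by omega)
      exact (condI_of_subset_box hsub).mono (by omega)
    exact ⟨by omega, hI _ le_rfl, le_rfl, fun l h1 h2 => ⟨hclean l (by omega) (by omega), hI l h2⟩⟩
  · omega

/-- «hence K = R_{j+1} for Z» WITH EQUALITY for a stopping index `K` (e.g. print՚s least one, when the flow leaves room): a stopping
index is `≥` the memory `R_{j+1}` (`B16StoppingRule.le_of_stopAt`) and `≤ R_{j+1}` by `K_le_R_of_small`. [cite: Balaban1989LargeFieldII, §1 p.386 l.3 (hence K = R_{j+1} for Z)] -/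
theorem K_eq_R_of_small {L : ℕ} {R : ℕ → ℕ} {Kf j K Nsz r₀ : ℕ} (hL : 3 ≤ L)
    (hD : DropCtl (fun i => Nat.log L (R (j + i))) (Kf - j)) (hr₀ : 22 ≤ r₀)
    {Z₀ : Finset (Pt d)} {c : Pt d} (hZ₀ : Z₀ ⊆ box c r₀) (hmK : j + 1 + K ≤ Kf) (hNsz : 2 * r₀ + 21 ≤ Nsz)
    (h1R : 1 ≤ R (j + 1)) (Clean : ℕ → Prop) (hclean : ∀ l, 1 ≤ l → l ≤ Kf - (j + 1) → Clean l)
    (hK : StopAt Nsz (R (j + 1)) Clean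
      (fun i => Siter (ratio L (fun i => Nat.log L (R (j + 1 + i)))) i
        (Sop (ratio L (fun i => Nat.log L (R (j + i))) 0) Z₀)) K)
    (hKmin : ∀ K', StopAt Nsz (R (j + 1)) Clean
      (fun i => Siter (ratio L (fun i => Nat.log L (R (j + 1 + i)))) i
        (Sop (ratio L (fun i => Nat.log L (R (j + i))) 0) Z₀)) K' → K ≤ K') :
    K = R (j + 1) :=
  le_antisymm (K_le_R_of_small hL hD hr₀ hZ₀ hmK hNsz h1R Clean hclean hKmin) (le_of_stopAt hK)

/-- **THE RESET OF p. 386 INHABITED IN THE INDEX MODEL.**  Along a flow of [III] §2 on `[0, K_f]` (the hypotheses of §8՚s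
`exists_birth_ofIndex` verbatim: `hI`, `hγ1`, `hR` (2.5), `hbR`, `h29a` (2.9a), `h27` (2.7), the located smallness `hΘ`, `L ≥ 4`,
`O(1), M ≥ 0`), an old component `Z₀c` of the scale-`j` data AT ITS HORIZON (`K(Z₀) = 0`: «Z₀ satisfies the conditions (i), (ii)»)
with a non-empty face-connected index region `Z₀ ⊆ □_c^{~r₀}` of `MR_j`-cubes (condition (i); `r₀ ≥ 22`, print `100` per side), the reset
component `Z = S(Z₀)` with a horizon `K` inside the flow not exceeding a stopping index for the memory `R_{j+1}` and a size parameter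
`Nsz ≥ 2r₀ + 21` (`hKmin`; cleanliness `Clean` after the reset), and a fresh amount `p` («the new factor exp(−p₀(g_j))») under the
LOCATED CONDITION `hcondR : 2(2r₀+21)^d·O(1)M^{d_b}L^{d_b+1}R_{j+1}^{d_b+2} ≤ p`: THEN §2՚s `ResetPiece` IS INHABITED with provenance `Z₀c`,
`p`, horizon `K` and the tree-length size profile of `Z`՚s `S`-iterates — its binder `hsmall` DISCHARGED («It satisfies (1.80),
because Z is a small domain …»: `K_le_R_of_small`, `Siter_subset_box_of_subset_box`, `treeLen_le_of_subset_box`,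
`sum_cost_le_of_small`). [cite: Balaban1989LargeFieldII, §1 p.385 (last lines)–p.386 l.1-3 (the reset)] -/
theorem exists_reset_ofIndex (b : Budget.Consts) {j : ℕ} (D : ScaleData j) (Z₀c : D.Comp) (hK0 : D.K Z₀c = 0)
    {L p Kf : ℕ} (hL : 4 ≤ L) {g : ℕ → ℝ} {γ β' β₀ : ℝ} (hI : Step.InInterval γ Kf g) (hγ1 : γ ≤ 1)
    (R : ℕ → ℕ) (hR : ∀ n, n ≤ Kf → B14.IsRj L p (g n) (R n)) (hbR : ∀ n, n ≤ Kf → b.R n = (R n : ℝ))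
    (h29a : ∀ m n, m < n → n ≤ Kf → (R n : ℝ) ≤ L * R m) (h27 : B14.FlowIneq27 g β' β₀ p Kf)
    (hΘ : ∀ m n, m < n → n ≤ Kf → (1 + (g n) ^ 2 * β' * ((n : ℝ) - m)) ^ β₀ ≤ (L : ℝ) ^ (max (n - m) 2 / 2))
    (hC : 0 ≤ b.C) (hM : 0 ≤ b.M) {Z₀ : Finset (Pt d)} (hZ₀ : Z₀.Nonempty) (hZ₀c : FaceConnected Z₀)
    {c : Pt d} {r₀ : ℕ} (hr₀ : 22 ≤ r₀) (hZ₀box : Z₀ ⊆ box c r₀)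
    (K : ℕ) (hmK : j + 1 + K ≤ Kf) (Nsz : ℕ) (hNsz : 2 * r₀ + 21 ≤ Nsz) (Clean : ℕ → Prop)
    (hclean : ∀ l, 1 ≤ l → l ≤ Kf - (j + 1) → Clean l)
    (hKmin : ∀ K', StopAt Nsz (R (j + 1)) Clean
      (fun i => Siter (ratio L (fun i => Nat.log L (R (j + 1 + i)))) i
        (Sop (ratio L (fun i => Nat.log L (R (j + i))) 0) Z₀)) K' → K ≤ K')
    (pR : ℝ) (hcondR : 2 * (2 * (r₀ : ℝ) + 21) ^ d *
      (b.C * b.M ^ b.d * (L : ℝ) ^ (b.d + 1) * b.R (j + 1) ^ (b.d + 2)) ≤ pR) :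
    ∃ x : ResetPiece b D, x.Z₀ = Z₀c ∧ x.p = pR ∧ x.K = K ∧
      x.size = fun n => treeLen (Siter (ratio L (fun i => Nat.log L (R (j + 1 + i)))) (n - (j + 1))
        (Sop (ratio L (fun i => Nat.log L (R (j + i))) 0) Z₀)) := by
  have hL3 : 3 ≤ L := by omega
  have hσ := exponents_log (show 1 < L by omega) R hR
  have hdrop := dropCtl_of_27b (by omega) hI hγ1 R (fun n => Nat.log L (R n)) hσ h27 hΘ
  have hD : DropCtl (fun i => Nat.log L (R (j + i))) (Kf - j) := dropCtl_shift hdrop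
  have h1R : 1 ≤ R (j + 1) := by
    rw [(hσ (j + 1) (by omega)).1]
    exact Nat.one_le_pow _ _ (by omega)
  have hKR : K ≤ R (j + 1) := K_le_R_of_small hL3 hD hr₀ hZ₀box hmK hNsz h1R Clean hclean hKmin
  have hsmall : ∑ n ∈ Finset.Ioc j (j + 1 + K), b.cost n
      ((fun n => treeLen (Siter (ratio L (fun i => Nat.log L (R (j + 1 + i)))) (n - (j + 1))
        (Sop (ratio L (fun i => Nat.log L (R (j + i))) 0) Z₀))) n) ≤ pR := by
    refine le_trans (sum_cost_le_of_small b (by omega) R hbR h29a hC hM hmK h1R hKR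
      ((2 * (r₀ : ℝ) + 21) ^ d) (by positivity) _ (fun n => treeLen_nonneg _) ?_) hcondR
    intro n hn
    have hn' := Finset.mem_Ioc.mp hn
    obtain ⟨c', hsub⟩ := Siter_subset_box_of_subset_box hL3 hD hr₀ hZ₀box (i := n - (j + 1) + 1) (by omega)
    have hne := Siter_nonempty (ratio L (fun i => Nat.log L (R (j + i)))) hZ₀ (n - (j + 1) + 1)
    have hfc := faceConnected_Siter (q := ratio L (fun i => Nat.log L (R (j + i))))
      (fun l => ratio_pos (show 0 < L by omega) _ l) hZ₀c (n - (j + 1) + 1)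
    have ht := treeLen_le_of_subset_box hne hfc hsub
    have hx : (2 * ((r₀ + 10 : ℕ) : ℝ) + 1) = 2 * (r₀ : ℝ) + 21 := by push_cast; ring
    rw [hx] at ht
    show treeLen _ ≤ _
    rw [← Siter_shift_log L R j (n - (j + 1)) Z₀]
    linarith
  exact ⟨⟨Z₀c, hK0, pR, _, K, hsmall⟩, rfl, rfl, rfl, rfl⟩

/-- **(1.80) FOR THE RESET COMPONENT IN THE INDEX MODEL, END TO END** («We define κ_{j+1}(Z) = p₀(g_j) − O(1)M^dR_{j+1}^{d+1}d′_{j+1}(Z).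
It satisfies (1.80)»): under the hypotheses of `exists_reset_ofIndex`, the budget `p − O(1)M^{d_b}R_{j+1}^{d_b+1}d′_{j+1}(Z)`,
`d′_{j+1}(Z) = treeLen (S(Z₀))`, CONTROLS the `K` steps of `Z = S(Z₀)` — `Step.Budget.Controls` at scale `j + 1` for the tree-length
profile of `Z`՚s iterates; `ResetPiece.controls` (`reset_p386`) of the inhabited reset data.  Inputs from outside the tree՚s kernel:
the flow displays of [III] §2, condition (i) for `Z₀` as a box of radius `r₀`, the located condition `hcondR`, the two size parameters,
and the reading of `K`. [cite: Balaban1989LargeFieldII, §1 p.386 l.1-3 (It satisfies (1.80))] -/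
theorem controls_reset_ofIndex (b : Budget.Consts) {j : ℕ} (D : ScaleData j) (Z₀c : D.Comp) (hK0 : D.K Z₀c = 0)
    {L p Kf : ℕ} (hL : 4 ≤ L) {g : ℕ → ℝ} {γ β' β₀ : ℝ} (hI : Step.InInterval γ Kf g) (hγ1 : γ ≤ 1)
    (R : ℕ → ℕ) (hR : ∀ n, n ≤ Kf → B14.IsRj L p (g n) (R n)) (hbR : ∀ n, n ≤ Kf → b.R n = (R n : ℝ))
    (h29a : ∀ m n, m < n → n ≤ Kf → (R n : ℝ) ≤ L * R m) (h27 : B14.FlowIneq27 g β' β₀ p Kf)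
    (hΘ : ∀ m n, m < n → n ≤ Kf → (1 + (g n) ^ 2 * β' * ((n : ℝ) - m)) ^ β₀ ≤ (L : ℝ) ^ (max (n - m) 2 / 2))
    (hC : 0 ≤ b.C) (hM : 0 ≤ b.M) {Z₀ : Finset (Pt d)} (hZ₀ : Z₀.Nonempty) (hZ₀c : FaceConnected Z₀)
    {c : Pt d} {r₀ : ℕ} (hr₀ : 22 ≤ r₀) (hZ₀box : Z₀ ⊆ box c r₀)
    (K : ℕ) (hmK : j + 1 + K ≤ Kf) (Nsz : ℕ) (hNsz : 2 * r₀ + 21 ≤ Nsz) (Clean : ℕ → Prop)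
    (hclean : ∀ l, 1 ≤ l → l ≤ Kf - (j + 1) → Clean l)
    (hKmin : ∀ K', StopAt Nsz (R (j + 1)) Clean
      (fun i => Siter (ratio L (fun i => Nat.log L (R (j + 1 + i)))) i
        (Sop (ratio L (fun i => Nat.log L (R (j + i))) 0) Z₀)) K' → K ≤ K')
    (pR : ℝ) (hcondR : 2 * (2 * (r₀ : ℝ) + 21) ^ d *
      (b.C * b.M ^ b.d * (L : ℝ) ^ (b.d + 1) * b.R (j + 1) ^ (b.d + 2)) ≤ pR) :
    Controls b (j + 1) K (pR - b.cost (j + 1) (treeLen (Sop (ratio L (fun i => Nat.log L (R (j + i))) 0) Z₀)))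
      (fun n => treeLen (Siter (ratio L (fun i => Nat.log L (R (j + 1 + i)))) (n - (j + 1))
        (Sop (ratio L (fun i => Nat.log L (R (j + i))) 0) Z₀))) := by
  obtain ⟨x, -, hp, hK, hs⟩ := exists_reset_ofIndex b D Z₀c hK0 hL hI hγ1 R hR hbR h29a h27 hΘ hC hM hZ₀ hZ₀c
    hr₀ hZ₀box K hmK Nsz hNsz Clean hclean hKmin pR hcondR
  have h := x.controls
  unfold ResetPiece.κ' at h
  rw [hK, hp, hs] at h
  simpa using h

end

end Literature.MathematicalPhysics.QuantumFieldTheory.Balaban1983to89.B16Lem384Induction
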